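import Literature.AlgebraicGeometry.ModuliOfAbelianVarieties.SiegelUniversalFamilyUniformisation   -- ★ p847075 P-3 NAMED FACT `siegelUniversalFamilyUniformisation` (the statement proved here)
import Literature.Geometry.ComplexAnalytic.RelativeExponentialUniformisation   -- ★ P-1 NAMED FACT `relativeExponentialUniformisation` + prefix currency (`IsRelExpChartOn`, `totalOver`, `basePoint`)
import Literature.AlgebraicGeometry.ModuliOfAbelianVarieties.SiegelUniversalFamilyPullbackAdmissibleNormalForm   -- ★ p847727 organ O2 ADM-NF (LA7-p01 (g0)): `exists_admPackage_normalForm_of_junction`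
import Literature.AlgebraicGeometry.ModuliOfAbelianVarieties.SiegelUniversalFamilyChartAlign   -- ★ p847835 organ O4 ALIGN (LA7-p01 (g0)): `exists_alignedChart_of_frameJLinear`
import Literature.AlgebraicGeometry.ModuliOfAbelianVarieties.SiegelShimuraSetPrincipalDissection   -- ★ `exists_principalRep` (integral representatives of `c`)
import Literature.AlgebraicGeometry.ModuliOfAbelianVarieties.SiegelUniversalFamilyChartGluing   -- ★ p847935 organ O6 GLUE (LA7-p02 (g0)): `SiegelUniversalFamilyChartGluing.chart_of_local`
import Literature.AlgebraicGeometry.ModuliOfAbelianVarieties.SiegelUniversalFamilyChartMatch   -- ★ p847965 organ O5 MATCH (LA7-p02 (g0)): `SiegelUniversalFamilyChartMatch.match_chart`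
import Literature.AlgebraicGeometry.ModuliOfAbelianVarieties.RelativeExponentialChartNormalise   -- ★ p847957 FLAT-a NORM₀ (LA7-p01 (g0)): `SiegelAdelicMarking.exists_normalisedChart`
import Literature.AlgebraicGeometry.ModuliOfAbelianVarieties.RelativeExponentialChartLevelReadings   -- ★ p848159 FLAT-b(i) (L=) (LA7-p02 (g0)): `levelReading_const`
import Literature.AlgebraicGeometry.ModuliOfAbelianVarieties.RelativeExponentialChartPairingReadingsGlobal   -- ★ p848424 FLAT-b(ii) (W=) (LA7-p02 (g0); (ii-F) ★ p848216 LA7-p01): `pairingReading_const`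
import Literature.AlgebraicGeometry.ModuliOfAbelianVarieties.SiegelUniversalFamilyChartPackageOfReadings   -- ★ p848162 FLAT-c (LA7-p01 (g0)): `exists_framePackage_of_readings`
import Literature.AlgebraicGeometry.ModuliOfAbelianVarieties.SiegelAdmissibleMarkingUniqueTorusTwoReps   -- ★ p848386 FLAT-d (LA7-p01 (g0)): `SiegelAdelicMarking.toFun_eq_toFun_of_lifts₂`
import Literature.Geometry.ComplexAnalytic.RelativeExponentialFlow   -- ★ p849279 (E1) ROAD B FLOW (LA7-plan (g2) pen, A-p15 (g19) filed): `exists_relExpFlow` — B1 p849240 · B2 p849248+p849219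
import Literature.Geometry.ComplexAnalytic.RelativeExponentialUniformisationOfFlow   -- ★ p849362 (E2a) FLOW ⇒ P-1 (LA1-plan (g2) pen, LA1-p04 (g2) filed): `relativeExponentialUniformisation_of_exists_relExpF
import HarnessLib

/-!
# ★ P-3 «UNIV-FAMILY» is a theorem: `siegelUniversalFamilyUniformisation_holds`

THEOREMS ONLY (no definition, no named fact, no instance, no notation, no `sorry`).  This file PROVES the named fact ★ P-3
`Literature.AlgebraicGeometry.ModuliOfAbelianVarieties.siegelUniversalFamilyUniformisation` (★ p847075, D-0014 `Prop` fact; the type of the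
E-LINE socket `stub_UNIVFAM`, crux `stmt-HodgeConjecture-24832` = hLiu418, half A line L7, SEATPLAN-GO500 v1 §1A row L7) over ★ Literature
alone.  It is the gate re-homing, token for token on the mathematics, of the crux workfile `Summits/HodgeConjecture/HodgeConjecture/Cruxes/HLiu418/
Lines/F0_P6a_StubUNIVFAM.lean` ED. 2 (sha16 594c6ad3483cf1a8, sorry-free, (IB) BUILT 2026-09-02T06:16:08Z; organs O2–O6 LA7-plan ∕ LA7-p01 ∕
LA7-p02 (g0), ED. 2 LA7-plan (g2∕g3)): the five organ `Prop`s of the workfile become the theorems `organ_admnf` ∕ `organ_flat` ∕ `organ_align` ∕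
`organ_match` ∕ `organ_glue` (statements = the workfile's `def` bodies verbatim, proofs = the workfile's `stub_*` proofs verbatim), organ O1 is
★ P-1 `relativeExponentialUniformisation` — a theorem of the tree: ★ p849362 `relativeExponentialUniformisation_of_exists_relExpFlow` applied to
★ p849279 `exists_relExpFlow` — and the head composes them exactly as the workfile's `stub_UNIVFAM_of_organs`.  A workfile under `Cruxes/…/Lines/`
cannot be imported by `Theorems/` or `Literature/` files; this file can, so every ★ consumer carrying the explicit binder
`(hP3 : siegelUniversalFamilyUniformisation)` (★ `exists_univFamilyChartCover_of_piece`, ★ `exists_isMonHom_reads_of_piece`,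
★ `exists_isMonHom_of_piece_readings`, ★ `exists_isMonHom_family_reads_of_piece`, ★ `exists_isMonHom_family_of_piece_readings`,
`Theorems/F0P6aReadsCReadingOfJunction`) may now discharge it BY NAME.
HC_CM is proved only modulo the 7 printed citations (2 remaining: hLiu418 = stmt-HodgeConjecture-24832, h413 = stmt-HodgeConjecture-24833)
until rung 0 closes; this file moves no count by itself — it turns one printed COMPOSITE row (P-3) into a gate theorem.

WHAT P-3 SAYS (★ `SiegelUniversalFamilyUniformisation.lean` :109–:186).  INPUTS: a Siegel fine moduli scheme `𝓜` (★ (F) — representability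
[Lan2013 Thm. 1.4.1.11 ∕ Cor. 7.2.3.9], [MFK94 Thm. 7.9] — is BOUND, not concluded), a piece `(c, S_c, ι_c, unif_c)` of `𝓜 ⊗ ℂ` with the
(U2+) clauses and the (U3) junction of ★ (U), a smooth complex variety `ψ : T → S_c`, analytifications `MT`, `MA` of `T` and of the total
space of `P_T := 𝓜.univ ×_𝓜 T`, an open `U ⊆ MT` with a holomorphic lift `s` of `ψ^an` through `unif_c`.  CONCLUSION: a relative exponential
chart (★ `IsRelExpChartOn`) of `MA → MT` over `U` whose period family is the TAUTOLOGICAL `t ↦ Π_{s t}` (★ `siegelPeriodMap`), (G) whose fibre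
maps are additive analytifications of the fibres, and (ADM) which ARE the admissible ★ `SiegelAdelicMarking`s by `[J(s t), r]` (`γ = 1`,
`Ψ = Π_{s t}`, torus map = chart fibre map) for every principal representative `r` of `c`.

THE PROOF.  P-3 = P-1 + ALIGNMENT + GLUING ([Lange2023AbelianVarietiesComplex] §3.4: Prop. 3.4.1, Lemma 3.4.7, Prop. 3.4.8, Ex. 3.4.5 (7);
[BirkenhakeLange2004] §8.7–§8.8):
* O1 (★ P-1) — a relative exponential chart of `(P_T.A)^an → T^an` near every point, with SOME holomorphic period family `Φ₀` and (G).
* O2 `organ_admnf` — POINTWISE ADMISSIBLE PACKAGES IN NORMAL FORM: at every `t ∈ U` and every principal representative `r` of `c`, the fibre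
  triple of `P_T` at `φT t` carries an (ADM)-package `(m, Θ, Λ)` by `[J(s t), r]` with `m.γ = 1`, `m.Ψ = Π_{s t}` ((U3∃) at `s t` transported
  along ★ `IsBaseChangeVia`: ★ `SiegelAdmissiblePackageAlongPullbacks`, ★ `SiegelAdelicMarkingRebaseToUnitBasis`; head ★ p847727).
* O3 `organ_flat` — NORMALISE AT `t₀` AND PROPAGATE («`c₁(λ)` is a flat section of `R²f_*ℤ`», [BirkenhakeLange2004] §8.7 Lemma 8.7.1;
  [Lange2023] proof of Prop. 3.4.8): from the P-1 chart `(Φ₀, ex₀)` near `t₀ ∈ U` and the packages of O2, an open `V' ∋ t₀`, `V' ⊆ U`, a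
  RE-FRAMED chart `(Φ₁, ex₁)` on `V'` and `Z : MT → 𝔥_g` with `Z t₀ = s t₀` such that AT EVERY `t ∈ V'` the chart fibre map of `ex₁` IS an
  (ADM)-package torus map by `[J(Z t), r]` with `γ = 1`, `Ψ = Φ₁ t` (★ p847957, ★ p848159, ★ p848424 (+ ★ p848216), ★ p848162, ★ p848386).
* O4 `organ_align` — RIEMANN RELATIONS + RE-FRAMING ([Lange2023] Lemma 3.4.7 ∕ Thm. 3.1.2; [BirkenhakeLange2004] Lemma 8.8.1): `C_t := Φ₁ t ∘
  Π_{Z t}⁻¹` is ℂ-linear and `Z`, `C` are holomorphic; re-framing by `C_t` gives `(Φ₂ = Π_Z, ex₂)` on `V'` with (C)(G)(ADM at `Z`) (★ p847835).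
* O5 `organ_match` — `Z = s` NEAR `t₀` ([Lange2023] Prop. 3.4.8 «universality» ∕ unique lifting through `𝔥_g → Γ_δ(N)\𝔥_g`, `N ≥ 3`): class
  uniqueness gives `s t = M_t • Z t`, `M_t ∈ Γ_δ(N)`, `M_{t₀} = 1` by freeness, local constancy by proper discontinuity (★ p847965).
* O6 `organ_glue` — UNIQUENESS GLUING over `U` ([Lange2023] Ex. 3.4.5 (7)): two local P-3 charts agree pointwise on overlaps (★
  `SiegelAdelicMarking.toFun_eq_toFun_of_lifts`, injectivity of `φA` ∕ `fibrePointToLeft`); ★ `IsRelExpChartOn` is local on the base (★ p847935).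
HEAD `siegelUniversalFamilyUniformisation_holds`: intro P-3's binders; by O6 it suffices to chart a neighbourhood of each `t₀ ∈ U`; O1 at
`(T, d, P.A, g, P.relDim, MT, φT, MA, φA)` and `t₀`; O3 → O4 → O5.  Every organ is stated BY VALUE over P-3's binder prefix :110–:158 VERBATIM.

Upstream (all ★ Literature; NO `Summits/…` import): ★ P-3 `siegelUniversalFamilyUniformisation`, ★ P-1 `relativeExponentialUniformisation` with
★ p849362 ∕ ★ p849279, ★ `IsRelExpChartOn`, ★ `SiegelAdelicMarking`, ★ `IsAdmissibleAt`, ★ `SiegelFineModuliScheme`,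
★ `PolarizedAbelianSchemeWithLevel.baseChange`, the organ heads ★ p847727 ∕ p847957 ∕ p848159 ∕ p848424 ∕ p848162 ∕ p848386 ∕ p847835 ∕ p847965 ∕
p847935 and ★ `exists_principalRep`.

References: [Lange2023AbelianVarietiesComplex] H. Lange, *Abelian Varieties over the Complex Numbers* (2023) §3.4 pp. 186–191;
[BirkenhakeLange2004] C. Birkenhake, H. Lange, *Complex Abelian Varieties* (2nd ed., 2004) §8.7–§8.8 pp. 229–234; [DeligneHodgeII1971]
P. Deligne, *Théorie de Hodge II*, Publ. IHÉS 40 (1971) §4.4 (4.4.2); [Milne2005ShimuraVarieties] J. S. Milne, *Introduction to Shimura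
varieties* (2005) §6 Thm. 6.11 p. 74; [MumfordFogartyKirwan1994] App. to Ch. 7 §A pp. 234–235; [SGA1] Exp. XII 1.2; [Lan2013] K.-W. Lan,
*Arithmetic compactifications of PEL-type Shimura varieties* (2013) Thm. 1.4.1.11, Cor. 7.2.3.9 (bound as `𝓜`, ★ (F)).
-/

set_option autoImplicit false

noncomputable section

open CategoryTheory CategoryTheory.Limits AlgebraicGeometry Matrix Topology
open scoped Manifold ContDiff Matrix.Norms.Elementwise
open Literature.AlgebraicGeometry
open Literature.AlgebraicGeometry.Motives (SchemeOver ComplexPoints AlgPoints specOver AbelianVariety CartierDivisor)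
open Literature.AlgebraicGeometry.AbelianSchemes (PolarizedAbelianSchemeWithLevel AbelianSchemeOver)
open Literature.AlgebraicGeometry.ModuliOfAbelianVarieties
open Literature.AlgebraicGeometry.ModuliOfAbelianVarieties.SiegelModuli (jOfSiegel)
open Literature.Geometry.Kaehler (ComplexTorus)
open Literature.Geometry.Kaehler.ComplexTorus (cover)
open Literature.Geometry.ComplexAnalytic (IsRelExpChartOn totalOver basePoint relativeExponentialUniformisation)
open Literature.NumberTheory.Transcendental (IsAnalytification)
open Literature.NumberTheory.Automorphic (siegelUpperHalfSpace)

namespace Literature.AlgebraicGeometry.ModuliOfAbelianVarieties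

namespace SiegelUniversalFamilyUniformisationHolds

/-! ## The five organs O2–O6 (THEOREMS; statements by value over P-3's binder prefix, proofs over ★ Literature) -/

/-- **Organ O2 `ADMNF` — pointwise admissible packages in NORMAL FORM along the lift.**  Under P-3's binders: for every principal
representative `r` of `c` and every `t ∈ U`, the fibre triple of `P := 𝓜.univ ×_𝓜 T` at `φT t` carries `(m, Θ, Λ)` with the three
★ `IsAdmissibleAt` conjuncts read at `φT t`, `m.γ = 1` and `m.Ψ = Π_{s t}` (= P-3's (ADM) block minus its last conjunct).
[cite: Milne2005ShimuraVarieties, §6 Thm. 6.11 p. 74] [cite: Lange2023AbelianVarietiesComplex, §3.4 Prop. 3.4.8 pp. 190–191]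
PROOF. **Organ O2 — PROVED** (LA7-p01 (g0), ★ p847727 `SiegelUniversalFamilyPullbackAdmissibleNormalForm`): the (U3∃) clause of the
bound junction at `Z := s t` (lift equation `unif (s t) = ψ (φT t)`) transported to the fibre of `P_T` at `φT t` and put in normal form by
★ `exists_admPackage_normalForm_of_junction`. [cite: Milne2005ShimuraVarieties, §6 Thm. 6.11 p. 74] -/
theorem organ_admnf :
  ∀ (g N : ℕ) (δ : Fin g → ℕ) (_hg : 0 < g) (hδ : IsPolarizationType δ) (_hN : 3 ≤ N) (𝓜 : SiegelFineModuliScheme g N δ)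
    -- a piece of `𝓜 ⊗ ℂ` with its uniformisation, satisfying the (U2+) clauses of ★ `siegelModuli_complexUniformisation` (P-3 :110–:121 verbatim)
    (c : (ZMod N)ˣ) (Sc : SchemeOver ℂ) (ιc : Sc ⟶ (Motives.baseChange ℚ ℂ).obj 𝓜.M)
    (unif : Matrix (Fin g) (Fin g) ℂ → ComplexPoints Sc)
    (_ : ContinuousOn unif (siegelUpperHalfSpace g)) (_ : IsOpenMap ((siegelUpperHalfSpace g).restrict unif))
    (_ : Set.SurjOn unif (siegelUpperHalfSpace g) Set.univ)
    (_ : ∀ Z ∈ siegelUpperHalfSpace g, ∀ Z' ∈ siegelUpperHalfSpace g,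
      unif Z = unif Z' ↔ ∃ M ∈ siegelLevelGroup δ N, ∃ C : (Fin g → ℂ) ≃ₗ[ℂ] (Fin g → ℂ),
        ∀ v : Fin g ⊕ Fin g → ℝ, C (siegelPeriodMap δ Z v) = siegelPeriodMap δ Z' (intAct M v))
    (_ : ∀ (V : Sc.left.affineOpens) (f : Sc.left.presheaf.obj (Opposite.op (↑V : Sc.left.Opens))),
      DifferentiableOn ℂ (fun Z ↦ AlgPoints.evalOrZero (↑V : Sc.left.Opens) f (unif Z))
        (siegelUpperHalfSpace g ∩ unif ⁻¹' {P | P.pt ∈ (↑V : Sc.left.Opens)}))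
    -- the (U3) junction for this piece (P-3 :123–:140 verbatim)
    (_ : ∀ (u : finAdeleQˣ) (r : gspFinAdelic δ),
      (∀ v, Valued.v ((u : finAdeleQ) v) = 1) →
      (u : finAdeleQ) - ((c : ZMod N).val : ℕ) ∈ levelIdeal N →
      r ∈ principalLevelSubgroup δ 1 →
      IsMultiplier (typeFormOver δ finAdeleQ) (r : GL (Fin g ⊕ Fin g) finAdeleQ) u →
      ((r : GL (Fin g ⊕ Fin g) finAdeleQ) : Matrix (Fin g ⊕ Fin g) (Fin g ⊕ Fin g) finAdeleQ) =
        Matrix.fromBlocks 1 0 0 ((u : finAdeleQ) • (1 : Matrix (Fin g) (Fin g) finAdeleQ)) →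
      ∀ (Z : Matrix (Fin g) (Fin g) ℂ) (hZ : Z ∈ siegelUpperHalfSpace g),
        haveI : IsLocallyNoetherian (specOver ℚ ℂ).left :=
          inferInstanceAs (IsLocallyNoetherian (Spec (CommRingCat.of ℂ)))
        (∃ (P' : PolarizedAbelianSchemeWithLevel g N δ (specOver ℚ ℂ).left)
            (G : P'.A.X.left ⟶ 𝓜.univ.A.X.left) (Ĝ : P'.D.hat.X.left ⟶ 𝓜.univ.D.hat.X.left),
            P'.IsBaseChangeVia 𝓜.univ
                ((AlgPoints.baseChangeEquiv (algebraMap ℚ ℂ) 𝓜.M).symm (AlgPoints.map ιc (unif Z))).left G Ĝ ∧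
            IsAdmissibleAt hδ r Z hZ P') ∧
        (∀ (P' : PolarizedAbelianSchemeWithLevel g N δ (specOver ℚ ℂ).left), IsAdmissibleAt hδ r Z hZ P' →
            AlgPoints.map ιc (unif Z)
              = AlgPoints.baseChangeEquiv (algebraMap ℚ ℂ) 𝓜.M (𝓜.classifyingMap (specOver ℚ ℂ) P')))
    -- a smooth complex variety over the piece and the pulled-back universal triple (P-3 :142–:158 verbatim)
    (T : SchemeOver ℂ) (d : ℕ) [LocallyOfFiniteType T.hom] [IsSeparated T.hom] [SmoothOfRelativeDimension d T.hom] (ψ : T ⟶ Sc)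
    (MT : Type) [TopologicalSpace MT] [ChartedSpace (Fin d → ℂ) MT] [IsManifold 𝓘(ℂ, Fin d → ℂ) ω MT]
    (φT : MT → ComplexPoints T) (hT : IsAnalytification (Fin d → ℂ) T d φT)
    (MA : Type) [TopologicalSpace MA] [ChartedSpace (Fin (d + g) → ℂ) MA] [IsManifold 𝓘(ℂ, Fin (d + g) → ℂ) ω MA]
    (φA : MA → ComplexPoints (totalOver T
      (𝓜.univ.baseChange (ψ.left ≫ ιc.left ≫ pullback.fst 𝓜.M.hom (Spec.map (CommRingCat.ofHom (algebraMap ℚ ℂ))))).A))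
    (_ : IsAnalytification (Fin (d + g) → ℂ) (totalOver T
      (𝓜.univ.baseChange (ψ.left ≫ ιc.left ≫ pullback.fst 𝓜.M.hom (Spec.map (CommRingCat.ofHom (algebraMap ℚ ℂ))))).A) (d + g) φA)
    (U : Set MT) (_ : IsOpen U) (s : MT → Matrix (Fin g) (Fin g) ℂ) (hs : ∀ t ∈ U, s t ∈ siegelUpperHalfSpace g)
    (_ : ∀ i j, MDifferentiableOn 𝓘(ℂ, Fin d → ℂ) 𝓘(ℂ, ℂ) (fun t => s t i j) U)
    (_ : ∀ t ∈ U, unif (s t) = AlgPoints.map ψ (φT t)),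
  letI P := 𝓜.univ.baseChange (ψ.left ≫ ιc.left ≫ pullback.fst 𝓜.M.hom (Spec.map (CommRingCat.ofHom (algebraMap ℚ ℂ))))
  (∀ (u : finAdeleQˣ) (r : gspFinAdelic δ),
    (∀ v, Valued.v ((u : finAdeleQ) v) = 1) →
    (u : finAdeleQ) - ((c : ZMod N).val : ℕ) ∈ levelIdeal N →
    r ∈ principalLevelSubgroup δ 1 →
    IsMultiplier (typeFormOver δ finAdeleQ) (r : GL (Fin g ⊕ Fin g) finAdeleQ) u →
    ((r : GL (Fin g ⊕ Fin g) finAdeleQ) : Matrix (Fin g ⊕ Fin g) (Fin g ⊕ Fin g) finAdeleQ) =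
      Matrix.fromBlocks 1 0 0 ((u : finAdeleQ) • (1 : Matrix (Fin g) (Fin g) finAdeleQ)) →
    ∀ (t : MT) (ht : t ∈ U),
      ∃ (m : SiegelAdelicMarking ⟨jOfSiegel δ (s t), SiegelComplexRecordSystem.jOfSiegel_mem_C0pm hδ.1 (hs t ht)⟩ r
            (P.A.fibre (φT t).left).toAbelianVariety)
        (Θ : CartierDivisor (P.A.fibre (φT t).left).toAbelianVariety.X.left)
        (Λ : P.level.SymplecticLift (φT t).left Θ δ),
        Θ.IsAmple ∧ P.A.IsLambdaOfAt (φT t).left P.D P.pol.lam Θ ∧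
        (∀ ⦃M : ℕ⦄, N ∣ M → M ≠ 0 → ∀ (x : Fin g ⊕ Fin g → ZMod M) (v : Fin g ⊕ Fin g → ℚ),
          AdelicCongr ((r⁻¹ : gspFinAdelic δ) : GL (Fin g ⊕ Fin g) finAdeleQ) 1 v (fun i => ((x i).val : ℚ) / M) →
            ((Λ.lift M (Multiplicative.ofAdd x)) : (P.A.fibre (φT t).left).toAbelianVariety.Points ℂ) = m.r v) ∧
        m.γ = 1 ∧ (∀ v : Fin g ⊕ Fin g → ℝ, m.Ψ v = siegelPeriodMap δ (s t) v)) := by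
  intro g N δ _hg hδ _hN 𝓜 c Sc ιc unif _hu₁ _hu₂ _hu₃ _hu₄ _hu₅ hU3 T d _i₁ _i₂ _i₃ ψ MT _i₄ _i₅ _i₆ φT hT MA _i₇ _i₈ _i₉ φA _hA U _hU
    s hs _hsd hlift u r h₁ h₂ h₃ h₄ h₅ t ht
  exact exists_admPackage_normalForm_of_junction hδ 𝓜 ιc ψ (φT t) (hlift t ht).symm h₃ (hs t ht)
    (hU3 u r h₁ h₂ h₃ h₄ h₅ (s t) (hs t ht)).1

/-- **Organ O3 `FLAT` — normalise a relative exponential chart at `t₀` and PROPAGATE admissibility along its frame.**  Under P-3's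
binders: given `t₀ ∈ U`, a relative exponential chart `(Φ₀, ex₀)` of `MA → MT` on some `U₀ ∋ t₀` with (G), and the packages of `ADMNF`,
there are an open `V' ∋ t₀`, `V' ⊆ U`, a chart `(Φ₁, ex₁)` on `V'` with (G), and `Z : MT → Matrix` with `Z t ∈ 𝔥_g` on `V'` and
`Z t₀ = s t₀`, such that at every `t ∈ V'` and for every principal representative `r` of `c` the chart fibre map of `ex₁` IS the torus map
of an (ADM)-package by `[J(Z t), r]` with `γ = 1` and `Ψ = Φ₁ t` («the first Chern class of the polarisation is a flat section»: the
type-`δ` symplectic reading and the level readings are constant along the continuous chart frame).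
[cite: BirkenhakeLange2004, §8.7 Lemma 8.7.1 pp. 229–231] [cite: Lange2023AbelianVarietiesComplex, §3.4 Prop. 3.4.8 pp. 190–191]
[cite: DeligneHodgeII1971, §4.4 (4.4.2)–(4.4.3) pp. 50–51]
PROOF. **Organ O3 `organ_flat` — PROVED IN-HOUSE** over ★ FLAT-a NORM₀ p847957 (`SiegelAdelicMarking.exists_normalisedChart`, LA7-p01),
★ FLAT-b(i) p848159 (`levelReading_const`, LA7-p02), ★ FLAT-b(ii) p848424 (`pairingReading_const`, LA7-p02; fibre reading ★ p848216 LA7-p01),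
★ FLAT-c p848162 (`exists_framePackage_of_readings`, LA7-p01) and ★ FLAT-d p848386 (`SiegelAdelicMarking.toFun_eq_toFun_of_lifts₂`, LA7-p01):
NORM₀ at `t₀` with the ADM-NF package through one principal representative `(u₀, r₀)` → a connected chart neighbourhood `V' ∋ t₀` in
`U ∩ U₀` (Mathlib `ChartedSpace.locallyConnectedSpace`) → `Z t := Z_{J(Φ₁ t)}` (★ `SiegelModuli.siegelOfJ`; `Z t₀ = s t₀` by ★
`jMatrix_siegelPeriodEquiv` + ★ `siegelOfJ_jOfSiegel`) → for every `(t, u, r)`: the `t₀`-package through `r` has the chart's torus map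
(FLAT-d), its level and Weil-pairing readings are constant along `V'` ((L=), (W=)), so ★ FLAT-c returns the frame package at `t`.
[cite: BirkenhakeLange2004, §8.7 Lemma 8.7.1 pp. 229–231] [cite: Milne2005ShimuraVarieties, §6 Thm. 6.11 pp. 74–75] -/
theorem organ_flat :
  ∀ (g N : ℕ) (δ : Fin g → ℕ) (_hg : 0 < g) (hδ : IsPolarizationType δ) (_hN : 3 ≤ N) (𝓜 : SiegelFineModuliScheme g N δ)
    -- a piece of `𝓜 ⊗ ℂ` with its uniformisation, satisfying the (U2+) clauses of ★ `siegelModuli_complexUniformisation` (P-3 :110–:121 verbatim)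
    (c : (ZMod N)ˣ) (Sc : SchemeOver ℂ) (ιc : Sc ⟶ (Motives.baseChange ℚ ℂ).obj 𝓜.M)
    (unif : Matrix (Fin g) (Fin g) ℂ → ComplexPoints Sc)
    (_ : ContinuousOn unif (siegelUpperHalfSpace g)) (_ : IsOpenMap ((siegelUpperHalfSpace g).restrict unif))
    (_ : Set.SurjOn unif (siegelUpperHalfSpace g) Set.univ)
    (_ : ∀ Z ∈ siegelUpperHalfSpace g, ∀ Z' ∈ siegelUpperHalfSpace g,
      unif Z = unif Z' ↔ ∃ M ∈ siegelLevelGroup δ N, ∃ C : (Fin g → ℂ) ≃ₗ[ℂ] (Fin g → ℂ),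
        ∀ v : Fin g ⊕ Fin g → ℝ, C (siegelPeriodMap δ Z v) = siegelPeriodMap δ Z' (intAct M v))
    (_ : ∀ (V : Sc.left.affineOpens) (f : Sc.left.presheaf.obj (Opposite.op (↑V : Sc.left.Opens))),
      DifferentiableOn ℂ (fun Z ↦ AlgPoints.evalOrZero (↑V : Sc.left.Opens) f (unif Z))
        (siegelUpperHalfSpace g ∩ unif ⁻¹' {P | P.pt ∈ (↑V : Sc.left.Opens)}))
    -- the (U3) junction for this piece (P-3 :123–:140 verbatim)
    (_ : ∀ (u : finAdeleQˣ) (r : gspFinAdelic δ),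
      (∀ v, Valued.v ((u : finAdeleQ) v) = 1) →
      (u : finAdeleQ) - ((c : ZMod N).val : ℕ) ∈ levelIdeal N →
      r ∈ principalLevelSubgroup δ 1 →
      IsMultiplier (typeFormOver δ finAdeleQ) (r : GL (Fin g ⊕ Fin g) finAdeleQ) u →
      ((r : GL (Fin g ⊕ Fin g) finAdeleQ) : Matrix (Fin g ⊕ Fin g) (Fin g ⊕ Fin g) finAdeleQ) =
        Matrix.fromBlocks 1 0 0 ((u : finAdeleQ) • (1 : Matrix (Fin g) (Fin g) finAdeleQ)) →
      ∀ (Z : Matrix (Fin g) (Fin g) ℂ) (hZ : Z ∈ siegelUpperHalfSpace g),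
        haveI : IsLocallyNoetherian (specOver ℚ ℂ).left :=
          inferInstanceAs (IsLocallyNoetherian (Spec (CommRingCat.of ℂ)))
        (∃ (P' : PolarizedAbelianSchemeWithLevel g N δ (specOver ℚ ℂ).left)
            (G : P'.A.X.left ⟶ 𝓜.univ.A.X.left) (Ĝ : P'.D.hat.X.left ⟶ 𝓜.univ.D.hat.X.left),
            P'.IsBaseChangeVia 𝓜.univ
                ((AlgPoints.baseChangeEquiv (algebraMap ℚ ℂ) 𝓜.M).symm (AlgPoints.map ιc (unif Z))).left G Ĝ ∧
            IsAdmissibleAt hδ r Z hZ P') ∧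
        (∀ (P' : PolarizedAbelianSchemeWithLevel g N δ (specOver ℚ ℂ).left), IsAdmissibleAt hδ r Z hZ P' →
            AlgPoints.map ιc (unif Z)
              = AlgPoints.baseChangeEquiv (algebraMap ℚ ℂ) 𝓜.M (𝓜.classifyingMap (specOver ℚ ℂ) P')))
    -- a smooth complex variety over the piece and the pulled-back universal triple (P-3 :142–:158 verbatim)
    (T : SchemeOver ℂ) (d : ℕ) [LocallyOfFiniteType T.hom] [IsSeparated T.hom] [SmoothOfRelativeDimension d T.hom] (ψ : T ⟶ Sc)
    (MT : Type) [TopologicalSpace MT] [ChartedSpace (Fin d → ℂ) MT] [IsManifold 𝓘(ℂ, Fin d → ℂ) ω MT]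
    (φT : MT → ComplexPoints T) (hT : IsAnalytification (Fin d → ℂ) T d φT)
    (MA : Type) [TopologicalSpace MA] [ChartedSpace (Fin (d + g) → ℂ) MA] [IsManifold 𝓘(ℂ, Fin (d + g) → ℂ) ω MA]
    (φA : MA → ComplexPoints (totalOver T
      (𝓜.univ.baseChange (ψ.left ≫ ιc.left ≫ pullback.fst 𝓜.M.hom (Spec.map (CommRingCat.ofHom (algebraMap ℚ ℂ))))).A))
    (_ : IsAnalytification (Fin (d + g) → ℂ) (totalOver T
      (𝓜.univ.baseChange (ψ.left ≫ ιc.left ≫ pullback.fst 𝓜.M.hom (Spec.map (CommRingCat.ofHom (algebraMap ℚ ℂ))))).A) (d + g) φA)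
    (U : Set MT) (_ : IsOpen U) (s : MT → Matrix (Fin g) (Fin g) ℂ) (hs : ∀ t ∈ U, s t ∈ siegelUpperHalfSpace g)
    (_ : ∀ i j, MDifferentiableOn 𝓘(ℂ, Fin d → ℂ) 𝓘(ℂ, ℂ) (fun t => s t i j) U)
    (_ : ∀ t ∈ U, unif (s t) = AlgPoints.map ψ (φT t))
    -- organ binders: the point, the raw chart with (G), the normal-form packages along `U`
    (t₀ : MT) (_ : t₀ ∈ U) (U₀ : Set MT) (Φ₀ : MT → ((Fin g ⊕ Fin g → ℝ) ≃L[ℝ] (Fin g → ℂ))) (ex₀ : MT × (Fin g → ℂ) → MA)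
    (_ : t₀ ∈ U₀),
  letI P := 𝓜.univ.baseChange (ψ.left ≫ ιc.left ≫ pullback.fst 𝓜.M.hom (Spec.map (CommRingCat.ofHom (algebraMap ℚ ℂ))))
  IsRelExpChartOn (Fin d → ℂ) (Fin (d + g) → ℂ) (basePoint hT P.A φA) U₀ Φ₀ ex₀ →
  (∀ t ∈ U₀, ∃ φt : ComplexTorus (Φ₀ t) → (P.A.fibre (φT t).left).toAbelianVariety.Points ℂ,
    IsAnalytification (Fin g → ℂ) (P.A.fibre (φT t).left).toAbelianVariety.X g φt ∧
    (∀ x y, φt (x + y) = φt x * φt y) ∧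
    ∀ z : Fin g → ℂ, (φA (ex₀ (t, z))).left = P.A.fibrePointToLeft (φT t).left (φt (cover (Φ₀ t) z))) →
  (∀ (u : finAdeleQˣ) (r : gspFinAdelic δ),
    (∀ v, Valued.v ((u : finAdeleQ) v) = 1) →
    (u : finAdeleQ) - ((c : ZMod N).val : ℕ) ∈ levelIdeal N →
    r ∈ principalLevelSubgroup δ 1 →
    IsMultiplier (typeFormOver δ finAdeleQ) (r : GL (Fin g ⊕ Fin g) finAdeleQ) u →
    ((r : GL (Fin g ⊕ Fin g) finAdeleQ) : Matrix (Fin g ⊕ Fin g) (Fin g ⊕ Fin g) finAdeleQ) =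
      Matrix.fromBlocks 1 0 0 ((u : finAdeleQ) • (1 : Matrix (Fin g) (Fin g) finAdeleQ)) →
    ∀ (t : MT) (ht : t ∈ U),
      ∃ (m : SiegelAdelicMarking ⟨jOfSiegel δ (s t), SiegelComplexRecordSystem.jOfSiegel_mem_C0pm hδ.1 (hs t ht)⟩ r
            (P.A.fibre (φT t).left).toAbelianVariety)
        (Θ : CartierDivisor (P.A.fibre (φT t).left).toAbelianVariety.X.left)
        (Λ : P.level.SymplecticLift (φT t).left Θ δ),
        Θ.IsAmple ∧ P.A.IsLambdaOfAt (φT t).left P.D P.pol.lam Θ ∧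
        (∀ ⦃M : ℕ⦄, N ∣ M → M ≠ 0 → ∀ (x : Fin g ⊕ Fin g → ZMod M) (v : Fin g ⊕ Fin g → ℚ),
          AdelicCongr ((r⁻¹ : gspFinAdelic δ) : GL (Fin g ⊕ Fin g) finAdeleQ) 1 v (fun i => ((x i).val : ℚ) / M) →
            ((Λ.lift M (Multiplicative.ofAdd x)) : (P.A.fibre (φT t).left).toAbelianVariety.Points ℂ) = m.r v) ∧
        m.γ = 1 ∧ (∀ v : Fin g ⊕ Fin g → ℝ, m.Ψ v = siegelPeriodMap δ (s t) v)) →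
  ∃ (V' : Set MT) (_ : IsOpen V') (_ : t₀ ∈ V') (_ : V' ⊆ U)
    (Φ₁ : MT → ((Fin g ⊕ Fin g → ℝ) ≃L[ℝ] (Fin g → ℂ))) (ex₁ : MT × (Fin g → ℂ) → MA)
    (Z : MT → Matrix (Fin g) (Fin g) ℂ) (hZ : ∀ t ∈ V', Z t ∈ siegelUpperHalfSpace g),
    Z t₀ = s t₀ ∧
    IsRelExpChartOn (Fin d → ℂ) (Fin (d + g) → ℂ) (basePoint hT P.A φA) V' Φ₁ ex₁ ∧
    (∀ t ∈ V', ∃ φt : ComplexTorus (Φ₁ t) → (P.A.fibre (φT t).left).toAbelianVariety.Points ℂ,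
      IsAnalytification (Fin g → ℂ) (P.A.fibre (φT t).left).toAbelianVariety.X g φt ∧
      (∀ x y, φt (x + y) = φt x * φt y) ∧
      ∀ z : Fin g → ℂ, (φA (ex₁ (t, z))).left = P.A.fibrePointToLeft (φT t).left (φt (cover (Φ₁ t) z))) ∧
    (∀ (u : finAdeleQˣ) (r : gspFinAdelic δ),
      (∀ v, Valued.v ((u : finAdeleQ) v) = 1) →
      (u : finAdeleQ) - ((c : ZMod N).val : ℕ) ∈ levelIdeal N →
      r ∈ principalLevelSubgroup δ 1 →
      IsMultiplier (typeFormOver δ finAdeleQ) (r : GL (Fin g ⊕ Fin g) finAdeleQ) u →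
      ((r : GL (Fin g ⊕ Fin g) finAdeleQ) : Matrix (Fin g ⊕ Fin g) (Fin g ⊕ Fin g) finAdeleQ) =
        Matrix.fromBlocks 1 0 0 ((u : finAdeleQ) • (1 : Matrix (Fin g) (Fin g) finAdeleQ)) →
      ∀ (t : MT) (ht : t ∈ V'),
        ∃ (m : SiegelAdelicMarking ⟨jOfSiegel δ (Z t), SiegelComplexRecordSystem.jOfSiegel_mem_C0pm hδ.1 (hZ t ht)⟩ r
              (P.A.fibre (φT t).left).toAbelianVariety)
          (Θ : CartierDivisor (P.A.fibre (φT t).left).toAbelianVariety.X.left)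
          (Λ : P.level.SymplecticLift (φT t).left Θ δ),
          Θ.IsAmple ∧ P.A.IsLambdaOfAt (φT t).left P.D P.pol.lam Θ ∧
          (∀ ⦃M : ℕ⦄, N ∣ M → M ≠ 0 → ∀ (x : Fin g ⊕ Fin g → ZMod M) (v : Fin g ⊕ Fin g → ℚ),
            AdelicCongr ((r⁻¹ : gspFinAdelic δ) : GL (Fin g ⊕ Fin g) finAdeleQ) 1 v (fun i => ((x i).val : ℚ) / M) →
              ((Λ.lift M (Multiplicative.ofAdd x)) : (P.A.fibre (φT t).left).toAbelianVariety.Points ℂ) = m.r v) ∧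
          m.γ = 1 ∧ (∀ v : Fin g ⊕ Fin g → ℝ, m.Ψ v = Φ₁ t v) ∧
          ∀ z : Fin g → ℂ, P.A.fibrePointToLeft (φT t).left (m.toFun (cover m.Ψ z)) = (φA (ex₁ (t, z))).left) := by
  intro g N δ hg hδ hN 𝓜 c Sc ιc unif _hu₁ _hu₂ _hu₃ _hu₄ _hu₅ _hU3 T d _i₁ _i₂ _i₃ ψ MT _i₄ _i₅ _i₆ φT hT MA _i₇ _i₈ _i₉ φA hA U hU
    s hs _hsd _hlift t₀ ht₀ U₀ Φ₀ ex₀ ht₀U₀ hC₀ hG₀ hNF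
  let P : PolarizedAbelianSchemeWithLevel g N δ T.left :=
    𝓜.univ.baseChange (ψ.left ≫ ιc.left ≫ pullback.fst 𝓜.M.hom (Spec.map (CommRingCat.ofHom (algebraMap ℚ ℂ))))
  have hN0 : N ≠ 0 := by omega
  -- commutativity of the abelian scheme `P.A` (for ★ FLAT-d): the smooth base `T` is locally Noetherian
  haveI : IsLocallyNoetherian T.left := LocallyOfFiniteType.isLocallyNoetherian T.hom
  haveI : IsCommMonObj P.A.X := P.A.isCommMonObj_of_isLocallyNoetherian_base
  -- a principal representative `(u₀, r₀)` of the residue `c` and the ADM-NF package at `t₀` through it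
  obtain ⟨u₀, r₀, h₁, h₂, h₃, h₄, h₅⟩ := exists_principalRep δ hN0 c
  obtain ⟨m₀, Θ₀, Λ₀, hample₀, hlam₀, htower₀, hγ₀, hΨ₀⟩ := hNF u₀ r₀ h₁ h₂ h₃ h₄ h₅ t₀ ht₀
  -- NORM₀: re-normalise the raw chart at `t₀` by `m₀`
  obtain ⟨Φ₁, ex₁, hC₁, hG₁, hΦ₁t₀, hjunc₀⟩ := SiegelAdelicMarking.exists_normalisedChart P.A hT φA hC₀ hG₀ ht₀U₀ m₀
  -- a connected open neighbourhood `V'` of `t₀` inside `U ∩ U₀`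
  haveI : LocallyConnectedSpace MT := ChartedSpace.locallyConnectedSpace (Fin d → ℂ) MT
  obtain ⟨V', hV'sub, hV'o, ht₀V', hV'conn⟩ :=
    locallyConnectedSpace_iff_subsets_isOpen_isConnected.mp ‹LocallyConnectedSpace MT› t₀ (U ∩ U₀)
      ((hU.inter hC₀.isOpen).mem_nhds ⟨ht₀, ht₀U₀⟩)
  have hV' : V' ⊆ U := fun x hx => (hV'sub hx).1
  have hV'U₀ : V' ⊆ U₀ := fun x hx => (hV'sub hx).2
  have hV'pre : IsPreconnected V' := hV'conn.isPreconnected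
  have hC₁' : IsRelExpChartOn (Fin d → ℂ) (Fin (d + g) → ℂ) (basePoint hT P.A φA) V' Φ₁ ex₁ := hC₁.mono hV'o hV'U₀
  have hG₁' : ∀ t ∈ V', ∃ φt : ComplexTorus (Φ₁ t) → (P.A.fibre (φT t).left).toAbelianVariety.Points ℂ,
      IsAnalytification (Fin g → ℂ) (P.A.fibre (φT t).left).toAbelianVariety.X g φt ∧
      (∀ x y, φt (x + y) = φt x * φt y) ∧
      ∀ z : Fin g → ℂ, (φA (ex₁ (t, z))).left = P.A.fibrePointToLeft (φT t).left (φt (cover (Φ₁ t) z)) :=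
    fun t ht => hG₁ t (hV'U₀ ht)
  have hΨ₀' : ∀ v : Fin g ⊕ Fin g → ℝ, m₀.Ψ v = Φ₁ t₀ v := fun v => by rw [hΦ₁t₀]
  -- KEY: the frame package at every `t ∈ V'` through every principal `(u, r)` (FLAT-c over (L=), (W=), FLAT-d)
  have key : ∀ (u : finAdeleQˣ) (r : gspFinAdelic δ),
      (∀ v, Valued.v ((u : finAdeleQ) v) = 1) →
      (u : finAdeleQ) - ((c : ZMod N).val : ℕ) ∈ levelIdeal N →
      r ∈ principalLevelSubgroup δ 1 →
      IsMultiplier (typeFormOver δ finAdeleQ) (r : GL (Fin g ⊕ Fin g) finAdeleQ) u →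
      ((r : GL (Fin g ⊕ Fin g) finAdeleQ) : Matrix (Fin g ⊕ Fin g) (Fin g ⊕ Fin g) finAdeleQ) =
        Matrix.fromBlocks 1 0 0 ((u : finAdeleQ) • (1 : Matrix (Fin g) (Fin g) finAdeleQ)) →
      ∀ t ∈ V', ∃ (Z' : Matrix (Fin g) (Fin g) ℂ) (hZ' : Z' ∈ siegelUpperHalfSpace g),
        ComplexTorus.jMatrix (Φ₁ t) = jOfSiegel δ Z' ∧
        ∃ (m : SiegelAdelicMarking ⟨jOfSiegel δ Z', SiegelComplexRecordSystem.jOfSiegel_mem_C0pm hδ.1 hZ'⟩ r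
              (P.A.fibre (φT t).left).toAbelianVariety)
          (Θ : CartierDivisor (P.A.fibre (φT t).left).toAbelianVariety.X.left)
          (Λ : P.level.SymplecticLift (φT t).left Θ δ),
          Θ.IsAmple ∧ P.A.IsLambdaOfAt (φT t).left P.D P.pol.lam Θ ∧
          (∀ ⦃M : ℕ⦄, N ∣ M → M ≠ 0 → ∀ (x : Fin g ⊕ Fin g → ZMod M) (v : Fin g ⊕ Fin g → ℚ),
            AdelicCongr ((r⁻¹ : gspFinAdelic δ) : GL (Fin g ⊕ Fin g) finAdeleQ) 1 v (fun i => ((x i).val : ℚ) / M) →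
              ((Λ.lift M (Multiplicative.ofAdd x)) : (P.A.fibre (φT t).left).toAbelianVariety.Points ℂ) = m.r v) ∧
          m.γ = 1 ∧ (∀ v : Fin g ⊕ Fin g → ℝ, m.Ψ v = Φ₁ t v) ∧
          ∀ z : Fin g → ℂ, P.A.fibrePointToLeft (φT t).left (m.toFun (cover m.Ψ z)) = (φA (ex₁ (t, z))).left := by
    intro u r k₁ k₂ k₃ k₄ k₅ t ht
    -- the ADM-NF packages through `r` at `t₀` and at `t`
    obtain ⟨m₁, Θ₁, Λ₁, hample₁, hlam₁, htower₁, hγ₁, hΨ₁⟩ := hNF u r k₁ k₂ k₃ k₄ k₅ t₀ ht₀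
    obtain ⟨_mt, Θt, _Λt, hamplet, hlamt, -, -, -⟩ := hNF u r k₁ k₂ k₃ k₄ k₅ t (hV' ht)
    -- FLAT-d: the torus map of `m₁` is that of `m₀`
    have hΨ₁₀ : ∀ v : Fin g ⊕ Fin g → ℝ, m₁.Ψ v = m₀.Ψ v := fun v => by rw [hΨ₁, hΨ₀]
    have htor : ∀ x : ComplexTorus m₀.Ψ, m₀.toFun x = m₁.toFun x := fun x =>
      SiegelAdelicMarking.toFun_eq_toFun_of_lifts₂ hg hδ hN h₁ h₂ h₃ h₄ h₅ k₁ k₂ k₃ k₄ k₅ (hs t₀ ht₀) m₀ Λ₀ hlam₀ htower₀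
        m₁ Λ₁ hlam₁ htower₁ hγ₀ hγ₁ x
    have hΨeq : m₁.Ψ = m₀.Ψ := by
      ext v i
      rw [hΨ₁₀]
    have hΨ₁' : ∀ v : Fin g ⊕ Fin g → ℝ, m₁.Ψ v = Φ₁ t₀ v := fun v => by rw [hΨ₁₀, hΨ₀']
    have hjunc₁ : ∀ z : Fin g → ℂ,
        P.A.fibrePointToLeft (φT t₀).left (m₁.toFun (cover m₁.Ψ z)) = (φA (ex₁ (t₀, z))).left := by
      intro z
      rw [hjunc₀ z, hΨeq, ← htor]
    -- FLAT-c at `(t, u, r)`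
    obtain ⟨Z', hZ', hj, m, Λ, htower, hγ, hΨ, hjunc⟩ :=
      exists_framePackage_of_readings hδ hg hN0 P φA (hG₁' t ht) k₃ (hs t₀ ht₀) m₁ Θ₁ Λ₁ hample₁ hlam₁ htower₁ hγ₁ hΨ₁'
        hjunc₁ Θt hamplet
        (RelativeExponentialChartLevelReadings.levelReading_const hN0 P hT φA hA hC₁' hV'pre hG₁' ht₀V' ht)
        (RelativeExponentialChartPairingReadings.pairingReading_const P hT φA hA hC₁' hV'pre hG₁' ht₀V' ht Θ₁ hlam₁ Θt hlamt)
    exact ⟨Z', hZ', hj, m, Θt, Λ, hamplet, hlamt, htower, hγ, hΨ, hjunc⟩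
  -- the matrix family `Z t := Z_{J(Φ₁ t)}` (★ `siegelOfJ`), in `𝔥_g` on `V'` and equal to `s` at `t₀`
  have hZeq : ∀ t : MT, ∀ {Z' : Matrix (Fin g) (Fin g) ℂ}, Z' ∈ siegelUpperHalfSpace g →
      ComplexTorus.jMatrix (Φ₁ t) = jOfSiegel δ Z' → SiegelModuli.siegelOfJ δ (ComplexTorus.jMatrix (Φ₁ t)) = Z' := by
    intro t Z' hZ' hj
    rw [hj, SiegelModuli.siegelOfJ_jOfSiegel hδ.1 hZ']
  have hZf : ∀ t ∈ V', SiegelModuli.siegelOfJ δ (ComplexTorus.jMatrix (Φ₁ t)) ∈ siegelUpperHalfSpace g := by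
    intro t ht
    obtain ⟨Z', hZ', hj, -⟩ := key u₀ r₀ h₁ h₂ h₃ h₄ h₅ t ht
    rw [hZeq t hZ' hj]
    exact hZ'
  have hZ₀ : SiegelModuli.siegelOfJ δ (ComplexTorus.jMatrix (Φ₁ t₀)) = s t₀ := by
    refine hZeq t₀ (hs t₀ ht₀) ?_
    have hΦ : Φ₁ t₀ = siegelPeriodEquiv hδ.1 (hs t₀ ht₀) := by
      rw [hΦ₁t₀]
      ext v i
      rw [hΨ₀, siegelPeriodEquiv_apply]
    rw [hΦ, SiegelModuli.jMatrix_siegelPeriodEquiv]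
  refine ⟨V', hV'o, ht₀V', hV', Φ₁, ex₁, fun t => SiegelModuli.siegelOfJ δ (ComplexTorus.jMatrix (Φ₁ t)), hZf, hZ₀, hC₁', hG₁', ?_⟩
  intro u r k₁ k₂ k₃ k₄ k₅ t ht
  obtain ⟨Z', hZ', hj, m, Θ, Λ, hample, hlam, htower, hγ, hΨ, hjunc⟩ := key u r k₁ k₂ k₃ k₄ k₅ t ht
  have hZt : SiegelModuli.siegelOfJ δ (ComplexTorus.jMatrix (Φ₁ t)) = Z' := hZeq t hZ' hj
  subst hZt
  exact ⟨m, Θ, Λ, hample, hlam, htower, hγ, hΨ, hjunc⟩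

/-- **Organ O4 `ALIGN` — Riemann relations and re-framing to the tautological periods `Π_Z`.**  Under P-3's binders: from `FLAT`'s output
on `V'` (chart `(Φ₁, ex₁)` with (G) whose fibre maps are (ADM)-package torus maps by `[J(Z t), r]` with `Ψ = Φ₁ t`), the matrix family `Z` is
holomorphic on `V'` and there is a chart `(Φ₂, ex₂)` on `V'` with `Φ₂ t = Π_{Z t}`, (C), (G) and (ADM at `Z t`) in P-3's normal form
(`γ = 1`, `Ψ = Π_{Z t}`, torus map = chart fibre map) — `C_t := Φ₁ t ∘ Π_{Z t}⁻¹` is ℂ-linear by the marking axiom `Ψ_J` and holomorphic in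
`t`, `ex₂ (t, z) := ex₁ (t, C_t z)`.
[cite: Lange2023AbelianVarietiesComplex, §3.4 Lemma 3.4.7 p. 189 + §3.1 Thm. 3.1.2 p. 163] [cite: BirkenhakeLange2004, §8.8 Lemma 8.8.1 pp. 232–233]
PROOF. **Organ O4 — PROVED** (LA7-p01 (g0), ★ p847835 `SiegelUniversalFamilyChartAlign`): the `J(Z t)`-linearity of the frame is read off
ONE package (at an integral representative `(u₀, r₀)` of `c`, ★ `exists_principalRep`; `m.γ = 1 ⇒ Ψ ∘ J = i·Ψ`, ★ `apply_mulVec_of_γ_eq_one`),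
★ `exists_alignedChart_of_frameJLinear` aligns the chart (`Z` holomorphic, `Φ = Π_Z`, TRANSPORT of every frame package to a normal-form
package for the re-framed `ex`), and the (G)∕(ADM) conjuncts are the two halves of TRANSPORT fed with `FLAT`'s packages.
[cite: BirkenhakeLange2004, §8.7 Lemma 8.7.1 p. 230] [cite: Milne2005ShimuraVarieties, §6 Thm. 6.11 p. 74] -/
theorem organ_align :
  ∀ (g N : ℕ) (δ : Fin g → ℕ) (_hg : 0 < g) (hδ : IsPolarizationType δ) (_hN : 3 ≤ N) (𝓜 : SiegelFineModuliScheme g N δ)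
    -- a piece of `𝓜 ⊗ ℂ` with its uniformisation, satisfying the (U2+) clauses of ★ `siegelModuli_complexUniformisation` (P-3 :110–:121 verbatim)
    (c : (ZMod N)ˣ) (Sc : SchemeOver ℂ) (ιc : Sc ⟶ (Motives.baseChange ℚ ℂ).obj 𝓜.M)
    (unif : Matrix (Fin g) (Fin g) ℂ → ComplexPoints Sc)
    (_ : ContinuousOn unif (siegelUpperHalfSpace g)) (_ : IsOpenMap ((siegelUpperHalfSpace g).restrict unif))
    (_ : Set.SurjOn unif (siegelUpperHalfSpace g) Set.univ)
    (_ : ∀ Z ∈ siegelUpperHalfSpace g, ∀ Z' ∈ siegelUpperHalfSpace g,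
      unif Z = unif Z' ↔ ∃ M ∈ siegelLevelGroup δ N, ∃ C : (Fin g → ℂ) ≃ₗ[ℂ] (Fin g → ℂ),
        ∀ v : Fin g ⊕ Fin g → ℝ, C (siegelPeriodMap δ Z v) = siegelPeriodMap δ Z' (intAct M v))
    (_ : ∀ (V : Sc.left.affineOpens) (f : Sc.left.presheaf.obj (Opposite.op (↑V : Sc.left.Opens))),
      DifferentiableOn ℂ (fun Z ↦ AlgPoints.evalOrZero (↑V : Sc.left.Opens) f (unif Z))
        (siegelUpperHalfSpace g ∩ unif ⁻¹' {P | P.pt ∈ (↑V : Sc.left.Opens)}))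
    -- the (U3) junction for this piece (P-3 :123–:140 verbatim)
    (_ : ∀ (u : finAdeleQˣ) (r : gspFinAdelic δ),
      (∀ v, Valued.v ((u : finAdeleQ) v) = 1) →
      (u : finAdeleQ) - ((c : ZMod N).val : ℕ) ∈ levelIdeal N →
      r ∈ principalLevelSubgroup δ 1 →
      IsMultiplier (typeFormOver δ finAdeleQ) (r : GL (Fin g ⊕ Fin g) finAdeleQ) u →
      ((r : GL (Fin g ⊕ Fin g) finAdeleQ) : Matrix (Fin g ⊕ Fin g) (Fin g ⊕ Fin g) finAdeleQ) =
        Matrix.fromBlocks 1 0 0 ((u : finAdeleQ) • (1 : Matrix (Fin g) (Fin g) finAdeleQ)) →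
      ∀ (Z : Matrix (Fin g) (Fin g) ℂ) (hZ : Z ∈ siegelUpperHalfSpace g),
        haveI : IsLocallyNoetherian (specOver ℚ ℂ).left :=
          inferInstanceAs (IsLocallyNoetherian (Spec (CommRingCat.of ℂ)))
        (∃ (P' : PolarizedAbelianSchemeWithLevel g N δ (specOver ℚ ℂ).left)
            (G : P'.A.X.left ⟶ 𝓜.univ.A.X.left) (Ĝ : P'.D.hat.X.left ⟶ 𝓜.univ.D.hat.X.left),
            P'.IsBaseChangeVia 𝓜.univ
                ((AlgPoints.baseChangeEquiv (algebraMap ℚ ℂ) 𝓜.M).symm (AlgPoints.map ιc (unif Z))).left G Ĝ ∧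
            IsAdmissibleAt hδ r Z hZ P') ∧
        (∀ (P' : PolarizedAbelianSchemeWithLevel g N δ (specOver ℚ ℂ).left), IsAdmissibleAt hδ r Z hZ P' →
            AlgPoints.map ιc (unif Z)
              = AlgPoints.baseChangeEquiv (algebraMap ℚ ℂ) 𝓜.M (𝓜.classifyingMap (specOver ℚ ℂ) P')))
    -- a smooth complex variety over the piece and the pulled-back universal triple (P-3 :142–:158 verbatim)
    (T : SchemeOver ℂ) (d : ℕ) [LocallyOfFiniteType T.hom] [IsSeparated T.hom] [SmoothOfRelativeDimension d T.hom] (ψ : T ⟶ Sc)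
    (MT : Type) [TopologicalSpace MT] [ChartedSpace (Fin d → ℂ) MT] [IsManifold 𝓘(ℂ, Fin d → ℂ) ω MT]
    (φT : MT → ComplexPoints T) (hT : IsAnalytification (Fin d → ℂ) T d φT)
    (MA : Type) [TopologicalSpace MA] [ChartedSpace (Fin (d + g) → ℂ) MA] [IsManifold 𝓘(ℂ, Fin (d + g) → ℂ) ω MA]
    (φA : MA → ComplexPoints (totalOver T
      (𝓜.univ.baseChange (ψ.left ≫ ιc.left ≫ pullback.fst 𝓜.M.hom (Spec.map (CommRingCat.ofHom (algebraMap ℚ ℂ))))).A))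
    (_ : IsAnalytification (Fin (d + g) → ℂ) (totalOver T
      (𝓜.univ.baseChange (ψ.left ≫ ιc.left ≫ pullback.fst 𝓜.M.hom (Spec.map (CommRingCat.ofHom (algebraMap ℚ ℂ))))).A) (d + g) φA)
    (U : Set MT) (_ : IsOpen U) (s : MT → Matrix (Fin g) (Fin g) ℂ) (hs : ∀ t ∈ U, s t ∈ siegelUpperHalfSpace g)
    (_ : ∀ i j, MDifferentiableOn 𝓘(ℂ, Fin d → ℂ) 𝓘(ℂ, ℂ) (fun t => s t i j) U)
    (_ : ∀ t ∈ U, unif (s t) = AlgPoints.map ψ (φT t))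
    -- organ binders: `FLAT`'s output
    (V' : Set MT) (_ : IsOpen V') (_ : V' ⊆ U)
    (Φ₁ : MT → ((Fin g ⊕ Fin g → ℝ) ≃L[ℝ] (Fin g → ℂ))) (ex₁ : MT × (Fin g → ℂ) → MA)
    (Z : MT → Matrix (Fin g) (Fin g) ℂ) (hZ : ∀ t ∈ V', Z t ∈ siegelUpperHalfSpace g),
  letI P := 𝓜.univ.baseChange (ψ.left ≫ ιc.left ≫ pullback.fst 𝓜.M.hom (Spec.map (CommRingCat.ofHom (algebraMap ℚ ℂ))))
  IsRelExpChartOn (Fin d → ℂ) (Fin (d + g) → ℂ) (basePoint hT P.A φA) V' Φ₁ ex₁ →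
  (∀ t ∈ V', ∃ φt : ComplexTorus (Φ₁ t) → (P.A.fibre (φT t).left).toAbelianVariety.Points ℂ,
    IsAnalytification (Fin g → ℂ) (P.A.fibre (φT t).left).toAbelianVariety.X g φt ∧
    (∀ x y, φt (x + y) = φt x * φt y) ∧
    ∀ z : Fin g → ℂ, (φA (ex₁ (t, z))).left = P.A.fibrePointToLeft (φT t).left (φt (cover (Φ₁ t) z))) →
  (∀ (u : finAdeleQˣ) (r : gspFinAdelic δ),
    (∀ v, Valued.v ((u : finAdeleQ) v) = 1) →
    (u : finAdeleQ) - ((c : ZMod N).val : ℕ) ∈ levelIdeal N →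
    r ∈ principalLevelSubgroup δ 1 →
    IsMultiplier (typeFormOver δ finAdeleQ) (r : GL (Fin g ⊕ Fin g) finAdeleQ) u →
    ((r : GL (Fin g ⊕ Fin g) finAdeleQ) : Matrix (Fin g ⊕ Fin g) (Fin g ⊕ Fin g) finAdeleQ) =
      Matrix.fromBlocks 1 0 0 ((u : finAdeleQ) • (1 : Matrix (Fin g) (Fin g) finAdeleQ)) →
    ∀ (t : MT) (ht : t ∈ V'),
      ∃ (m : SiegelAdelicMarking ⟨jOfSiegel δ (Z t), SiegelComplexRecordSystem.jOfSiegel_mem_C0pm hδ.1 (hZ t ht)⟩ r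
            (P.A.fibre (φT t).left).toAbelianVariety)
        (Θ : CartierDivisor (P.A.fibre (φT t).left).toAbelianVariety.X.left)
        (Λ : P.level.SymplecticLift (φT t).left Θ δ),
        Θ.IsAmple ∧ P.A.IsLambdaOfAt (φT t).left P.D P.pol.lam Θ ∧
        (∀ ⦃M : ℕ⦄, N ∣ M → M ≠ 0 → ∀ (x : Fin g ⊕ Fin g → ZMod M) (v : Fin g ⊕ Fin g → ℚ),
          AdelicCongr ((r⁻¹ : gspFinAdelic δ) : GL (Fin g ⊕ Fin g) finAdeleQ) 1 v (fun i => ((x i).val : ℚ) / M) →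
            ((Λ.lift M (Multiplicative.ofAdd x)) : (P.A.fibre (φT t).left).toAbelianVariety.Points ℂ) = m.r v) ∧
        m.γ = 1 ∧ (∀ v : Fin g ⊕ Fin g → ℝ, m.Ψ v = Φ₁ t v) ∧
        ∀ z : Fin g → ℂ, P.A.fibrePointToLeft (φT t).left (m.toFun (cover m.Ψ z)) = (φA (ex₁ (t, z))).left) →
  ∃ (Φ₂ : MT → ((Fin g ⊕ Fin g → ℝ) ≃L[ℝ] (Fin g → ℂ))) (ex₂ : MT × (Fin g → ℂ) → MA),
    (∀ i j, MDifferentiableOn 𝓘(ℂ, Fin d → ℂ) 𝓘(ℂ, ℂ) (fun t => Z t i j) V') ∧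
    (∀ t ∈ V', ∀ v : Fin g ⊕ Fin g → ℝ, Φ₂ t v = siegelPeriodMap δ (Z t) v) ∧
    IsRelExpChartOn (Fin d → ℂ) (Fin (d + g) → ℂ) (basePoint hT P.A φA) V' Φ₂ ex₂ ∧
    (∀ t ∈ V', ∃ φt : ComplexTorus (Φ₂ t) → (P.A.fibre (φT t).left).toAbelianVariety.Points ℂ,
      IsAnalytification (Fin g → ℂ) (P.A.fibre (φT t).left).toAbelianVariety.X g φt ∧
      (∀ x y, φt (x + y) = φt x * φt y) ∧
      ∀ z : Fin g → ℂ, (φA (ex₂ (t, z))).left = P.A.fibrePointToLeft (φT t).left (φt (cover (Φ₂ t) z))) ∧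
    (∀ (u : finAdeleQˣ) (r : gspFinAdelic δ),
      (∀ v, Valued.v ((u : finAdeleQ) v) = 1) →
      (u : finAdeleQ) - ((c : ZMod N).val : ℕ) ∈ levelIdeal N →
      r ∈ principalLevelSubgroup δ 1 →
      IsMultiplier (typeFormOver δ finAdeleQ) (r : GL (Fin g ⊕ Fin g) finAdeleQ) u →
      ((r : GL (Fin g ⊕ Fin g) finAdeleQ) : Matrix (Fin g ⊕ Fin g) (Fin g ⊕ Fin g) finAdeleQ) =
        Matrix.fromBlocks 1 0 0 ((u : finAdeleQ) • (1 : Matrix (Fin g) (Fin g) finAdeleQ)) →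
      ∀ (t : MT) (ht : t ∈ V'),
        ∃ (m : SiegelAdelicMarking ⟨jOfSiegel δ (Z t), SiegelComplexRecordSystem.jOfSiegel_mem_C0pm hδ.1 (hZ t ht)⟩ r
              (P.A.fibre (φT t).left).toAbelianVariety)
          (Θ : CartierDivisor (P.A.fibre (φT t).left).toAbelianVariety.X.left)
          (Λ : P.level.SymplecticLift (φT t).left Θ δ),
          Θ.IsAmple ∧ P.A.IsLambdaOfAt (φT t).left P.D P.pol.lam Θ ∧
          (∀ ⦃M : ℕ⦄, N ∣ M → M ≠ 0 → ∀ (x : Fin g ⊕ Fin g → ZMod M) (v : Fin g ⊕ Fin g → ℚ),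
            AdelicCongr ((r⁻¹ : gspFinAdelic δ) : GL (Fin g ⊕ Fin g) finAdeleQ) 1 v (fun i => ((x i).val : ℚ) / M) →
              ((Λ.lift M (Multiplicative.ofAdd x)) : (P.A.fibre (φT t).left).toAbelianVariety.Points ℂ) = m.r v) ∧
          m.γ = 1 ∧ (∀ v : Fin g ⊕ Fin g → ℝ, m.Ψ v = siegelPeriodMap δ (Z t) v) ∧
          ∀ z : Fin g → ℂ, P.A.fibrePointToLeft (φT t).left (m.toFun (cover m.Ψ z)) = (φA (ex₂ (t, z))).left) := by
  intro g N δ _hg hδ hN 𝓜 c Sc ιc unif _hu₁ _hu₂ _hu₃ _hu₄ _hu₅ _hU3 T d _i₁ _i₂ _i₃ ψ MT _i₄ _i₅ _i₆ φT hT MA _i₇ _i₈ _i₉ φA _hA U _hU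
    s _hs _hsd _hlift V' _hV'o _hV'U Φ₁ ex₁ Z hZ hC₁ _hG₁ hADM₁
  -- an integral representative `(u₀, r₀)` of `c`: ONE package suffices to read the `J(Z t)`-linearity of the frame `Φ₁ t`
  obtain ⟨u₀, r₀, h₁, h₂, h₃, h₄, h₅⟩ := exists_principalRep δ (by omega : N ≠ 0) c
  have hJ : ∀ t ∈ V', ∀ x, Φ₁ t (jOfSiegel δ (Z t) *ᵥ x) = Complex.I • Φ₁ t x := by
    intro t ht x
    obtain ⟨m₁, Θ, Λ, -, -, -, hγ₁, hΨ₁, -⟩ := hADM₁ u₀ r₀ h₁ h₂ h₃ h₄ h₅ t ht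
    simpa only [hΨ₁] using m₁.apply_mulVec_of_γ_eq_one hγ₁ x
  obtain ⟨hZd, Φ, ex, hT, hC, hTR⟩ :=
    exists_alignedChart_of_frameJLinear hδ 𝓜 ιc T d ψ MT φT hT MA φA V' Φ₁ ex₁ hC₁ Z hZ hJ
  exact ⟨Φ, ex, hZd, hT, hC, fun t ht => (hTR r₀ t ht (hADM₁ u₀ r₀ h₁ h₂ h₃ h₄ h₅ t ht)).1,
    fun u r h₁' h₂' h₃' h₄' h₅' t ht => (hTR r t ht (hADM₁ u r h₁' h₂' h₃' h₄' h₅' t ht)).2⟩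

/-- **Organ O5 `MATCH` — the period matrix of an admissibly marked chart IS the lift: `Z = s` near `t₀`.**  Under P-3's binders: a chart
`(Φ₂, ex₂)` on an open `V' ∋ t₀`, `V' ⊆ U`, in P-3's normal form at a holomorphic `Z : V' → 𝔥_g` with `Z t₀ = s t₀`, together with the
packages of `ADMNF` at `s`, restricts on some open `V'' ∋ t₀`, `V'' ⊆ U`, to a chart with the FOUR P-3 conjuncts AT `s` (class uniqueness
`s t = M_t • Z t`, `M_t ∈ Γ_δ(N)`, `M_{t₀} = 1` by freeness (`N ≥ 3`), local constancy by proper discontinuity ∕ unique lifting through `unif_c`).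
[cite: Lange2023AbelianVarietiesComplex, §3.4 Prop. 3.4.8 + Ex. 3.4.5 (7) pp. 190–191] [cite: BirkenhakeLange2004, §8.8 pp. 232–234]
[cite: Milne2005ShimuraVarieties, §6 Thm. 6.11 p. 74]
PROOF. **Organ O5 — PROVED** (LA7-p02 (g0), ★ p847965 `SiegelUniversalFamilyChartMatch`): at an integral representative `(u₀, r₀)` of `c`
(★ `exists_principalRep`) the (ADM) package at `Z t` and the `ADMNF` package at `s t` are two admissible markings of ONE fibre, so
`⟨s t⟩ = M_t • ⟨Z t⟩` with `M_t ∈ Γ_δ(N)` (★ `exists_siegelLevelGroup_smul_ratRep_of_lifts`); `Z`, `s` continuous and `Z t₀ = s t₀` force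
`Z = s` on an open `V'' ∋ t₀` (★ LIFT-UNIQ p847785 `exists_open_eqOn_of_exists_gDHom_smul`: `Γ_δ(N)` acts freely and properly
discontinuously, `N ≥ 3`); the chart restricts (`.mono`) and TAUT∕(ADM) are transported along `Z t = s t`; head `match_chart` = `MATCH` minus
its unused binders. [cite: Lange2023AbelianVarietiesComplex, §3.4 Prop. 3.4.8 + Ex. 3.4.5 (7) pp. 190–191]
[cite: BirkenhakeLange2004, §8.8 pp. 232–234] [cite: Milne2005ShimuraVarieties, §6 Thm. 6.11 p. 74] -/
theorem organ_match :
  ∀ (g N : ℕ) (δ : Fin g → ℕ) (_hg : 0 < g) (hδ : IsPolarizationType δ) (_hN : 3 ≤ N) (𝓜 : SiegelFineModuliScheme g N δ)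
    -- a piece of `𝓜 ⊗ ℂ` with its uniformisation, satisfying the (U2+) clauses of ★ `siegelModuli_complexUniformisation` (P-3 :110–:121 verbatim)
    (c : (ZMod N)ˣ) (Sc : SchemeOver ℂ) (ιc : Sc ⟶ (Motives.baseChange ℚ ℂ).obj 𝓜.M)
    (unif : Matrix (Fin g) (Fin g) ℂ → ComplexPoints Sc)
    (_ : ContinuousOn unif (siegelUpperHalfSpace g)) (_ : IsOpenMap ((siegelUpperHalfSpace g).restrict unif))
    (_ : Set.SurjOn unif (siegelUpperHalfSpace g) Set.univ)
    (_ : ∀ Z ∈ siegelUpperHalfSpace g, ∀ Z' ∈ siegelUpperHalfSpace g,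
      unif Z = unif Z' ↔ ∃ M ∈ siegelLevelGroup δ N, ∃ C : (Fin g → ℂ) ≃ₗ[ℂ] (Fin g → ℂ),
        ∀ v : Fin g ⊕ Fin g → ℝ, C (siegelPeriodMap δ Z v) = siegelPeriodMap δ Z' (intAct M v))
    (_ : ∀ (V : Sc.left.affineOpens) (f : Sc.left.presheaf.obj (Opposite.op (↑V : Sc.left.Opens))),
      DifferentiableOn ℂ (fun Z ↦ AlgPoints.evalOrZero (↑V : Sc.left.Opens) f (unif Z))
        (siegelUpperHalfSpace g ∩ unif ⁻¹' {P | P.pt ∈ (↑V : Sc.left.Opens)}))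
    -- the (U3) junction for this piece (P-3 :123–:140 verbatim)
    (_ : ∀ (u : finAdeleQˣ) (r : gspFinAdelic δ),
      (∀ v, Valued.v ((u : finAdeleQ) v) = 1) →
      (u : finAdeleQ) - ((c : ZMod N).val : ℕ) ∈ levelIdeal N →
      r ∈ principalLevelSubgroup δ 1 →
      IsMultiplier (typeFormOver δ finAdeleQ) (r : GL (Fin g ⊕ Fin g) finAdeleQ) u →
      ((r : GL (Fin g ⊕ Fin g) finAdeleQ) : Matrix (Fin g ⊕ Fin g) (Fin g ⊕ Fin g) finAdeleQ) =
        Matrix.fromBlocks 1 0 0 ((u : finAdeleQ) • (1 : Matrix (Fin g) (Fin g) finAdeleQ)) →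
      ∀ (Z : Matrix (Fin g) (Fin g) ℂ) (hZ : Z ∈ siegelUpperHalfSpace g),
        haveI : IsLocallyNoetherian (specOver ℚ ℂ).left :=
          inferInstanceAs (IsLocallyNoetherian (Spec (CommRingCat.of ℂ)))
        (∃ (P' : PolarizedAbelianSchemeWithLevel g N δ (specOver ℚ ℂ).left)
            (G : P'.A.X.left ⟶ 𝓜.univ.A.X.left) (Ĝ : P'.D.hat.X.left ⟶ 𝓜.univ.D.hat.X.left),
            P'.IsBaseChangeVia 𝓜.univ
                ((AlgPoints.baseChangeEquiv (algebraMap ℚ ℂ) 𝓜.M).symm (AlgPoints.map ιc (unif Z))).left G Ĝ ∧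
            IsAdmissibleAt hδ r Z hZ P') ∧
        (∀ (P' : PolarizedAbelianSchemeWithLevel g N δ (specOver ℚ ℂ).left), IsAdmissibleAt hδ r Z hZ P' →
            AlgPoints.map ιc (unif Z)
              = AlgPoints.baseChangeEquiv (algebraMap ℚ ℂ) 𝓜.M (𝓜.classifyingMap (specOver ℚ ℂ) P')))
    -- a smooth complex variety over the piece and the pulled-back universal triple (P-3 :142–:158 verbatim)
    (T : SchemeOver ℂ) (d : ℕ) [LocallyOfFiniteType T.hom] [IsSeparated T.hom] [SmoothOfRelativeDimension d T.hom] (ψ : T ⟶ Sc)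
    (MT : Type) [TopologicalSpace MT] [ChartedSpace (Fin d → ℂ) MT] [IsManifold 𝓘(ℂ, Fin d → ℂ) ω MT]
    (φT : MT → ComplexPoints T) (hT : IsAnalytification (Fin d → ℂ) T d φT)
    (MA : Type) [TopologicalSpace MA] [ChartedSpace (Fin (d + g) → ℂ) MA] [IsManifold 𝓘(ℂ, Fin (d + g) → ℂ) ω MA]
    (φA : MA → ComplexPoints (totalOver T
      (𝓜.univ.baseChange (ψ.left ≫ ιc.left ≫ pullback.fst 𝓜.M.hom (Spec.map (CommRingCat.ofHom (algebraMap ℚ ℂ))))).A))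
    (_ : IsAnalytification (Fin (d + g) → ℂ) (totalOver T
      (𝓜.univ.baseChange (ψ.left ≫ ιc.left ≫ pullback.fst 𝓜.M.hom (Spec.map (CommRingCat.ofHom (algebraMap ℚ ℂ))))).A) (d + g) φA)
    (U : Set MT) (_ : IsOpen U) (s : MT → Matrix (Fin g) (Fin g) ℂ) (hs : ∀ t ∈ U, s t ∈ siegelUpperHalfSpace g)
    (_ : ∀ i j, MDifferentiableOn 𝓘(ℂ, Fin d → ℂ) 𝓘(ℂ, ℂ) (fun t => s t i j) U)
    (_ : ∀ t ∈ U, unif (s t) = AlgPoints.map ψ (φT t))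
    -- organ binders: the point, `ALIGN`'s output, the normal-form packages along `U`
    (t₀ : MT) (V' : Set MT) (_ : IsOpen V') (_ : t₀ ∈ V') (_ : V' ⊆ U)
    (Z : MT → Matrix (Fin g) (Fin g) ℂ) (hZ : ∀ t ∈ V', Z t ∈ siegelUpperHalfSpace g)
    (_ : ∀ i j, MDifferentiableOn 𝓘(ℂ, Fin d → ℂ) 𝓘(ℂ, ℂ) (fun t => Z t i j) V') (_ : Z t₀ = s t₀)
    (Φ₂ : MT → ((Fin g ⊕ Fin g → ℝ) ≃L[ℝ] (Fin g → ℂ))) (ex₂ : MT × (Fin g → ℂ) → MA),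
  letI P := 𝓜.univ.baseChange (ψ.left ≫ ιc.left ≫ pullback.fst 𝓜.M.hom (Spec.map (CommRingCat.ofHom (algebraMap ℚ ℂ))))
  (∀ t ∈ V', ∀ v : Fin g ⊕ Fin g → ℝ, Φ₂ t v = siegelPeriodMap δ (Z t) v) →
  IsRelExpChartOn (Fin d → ℂ) (Fin (d + g) → ℂ) (basePoint hT P.A φA) V' Φ₂ ex₂ →
  (∀ t ∈ V', ∃ φt : ComplexTorus (Φ₂ t) → (P.A.fibre (φT t).left).toAbelianVariety.Points ℂ,
    IsAnalytification (Fin g → ℂ) (P.A.fibre (φT t).left).toAbelianVariety.X g φt ∧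
    (∀ x y, φt (x + y) = φt x * φt y) ∧
    ∀ z : Fin g → ℂ, (φA (ex₂ (t, z))).left = P.A.fibrePointToLeft (φT t).left (φt (cover (Φ₂ t) z))) →
  (∀ (u : finAdeleQˣ) (r : gspFinAdelic δ),
    (∀ v, Valued.v ((u : finAdeleQ) v) = 1) →
    (u : finAdeleQ) - ((c : ZMod N).val : ℕ) ∈ levelIdeal N →
    r ∈ principalLevelSubgroup δ 1 →
    IsMultiplier (typeFormOver δ finAdeleQ) (r : GL (Fin g ⊕ Fin g) finAdeleQ) u →
    ((r : GL (Fin g ⊕ Fin g) finAdeleQ) : Matrix (Fin g ⊕ Fin g) (Fin g ⊕ Fin g) finAdeleQ) =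
      Matrix.fromBlocks 1 0 0 ((u : finAdeleQ) • (1 : Matrix (Fin g) (Fin g) finAdeleQ)) →
    ∀ (t : MT) (ht : t ∈ V'),
      ∃ (m : SiegelAdelicMarking ⟨jOfSiegel δ (Z t), SiegelComplexRecordSystem.jOfSiegel_mem_C0pm hδ.1 (hZ t ht)⟩ r
            (P.A.fibre (φT t).left).toAbelianVariety)
        (Θ : CartierDivisor (P.A.fibre (φT t).left).toAbelianVariety.X.left)
        (Λ : P.level.SymplecticLift (φT t).left Θ δ),
        Θ.IsAmple ∧ P.A.IsLambdaOfAt (φT t).left P.D P.pol.lam Θ ∧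
        (∀ ⦃M : ℕ⦄, N ∣ M → M ≠ 0 → ∀ (x : Fin g ⊕ Fin g → ZMod M) (v : Fin g ⊕ Fin g → ℚ),
          AdelicCongr ((r⁻¹ : gspFinAdelic δ) : GL (Fin g ⊕ Fin g) finAdeleQ) 1 v (fun i => ((x i).val : ℚ) / M) →
            ((Λ.lift M (Multiplicative.ofAdd x)) : (P.A.fibre (φT t).left).toAbelianVariety.Points ℂ) = m.r v) ∧
        m.γ = 1 ∧ (∀ v : Fin g ⊕ Fin g → ℝ, m.Ψ v = siegelPeriodMap δ (Z t) v) ∧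
        ∀ z : Fin g → ℂ, P.A.fibrePointToLeft (φT t).left (m.toFun (cover m.Ψ z)) = (φA (ex₂ (t, z))).left) →
  (∀ (u : finAdeleQˣ) (r : gspFinAdelic δ),
    (∀ v, Valued.v ((u : finAdeleQ) v) = 1) →
    (u : finAdeleQ) - ((c : ZMod N).val : ℕ) ∈ levelIdeal N →
    r ∈ principalLevelSubgroup δ 1 →
    IsMultiplier (typeFormOver δ finAdeleQ) (r : GL (Fin g ⊕ Fin g) finAdeleQ) u →
    ((r : GL (Fin g ⊕ Fin g) finAdeleQ) : Matrix (Fin g ⊕ Fin g) (Fin g ⊕ Fin g) finAdeleQ) =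
      Matrix.fromBlocks 1 0 0 ((u : finAdeleQ) • (1 : Matrix (Fin g) (Fin g) finAdeleQ)) →
    ∀ (t : MT) (ht : t ∈ U),
      ∃ (m : SiegelAdelicMarking ⟨jOfSiegel δ (s t), SiegelComplexRecordSystem.jOfSiegel_mem_C0pm hδ.1 (hs t ht)⟩ r
            (P.A.fibre (φT t).left).toAbelianVariety)
        (Θ : CartierDivisor (P.A.fibre (φT t).left).toAbelianVariety.X.left)
        (Λ : P.level.SymplecticLift (φT t).left Θ δ),
        Θ.IsAmple ∧ P.A.IsLambdaOfAt (φT t).left P.D P.pol.lam Θ ∧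
        (∀ ⦃M : ℕ⦄, N ∣ M → M ≠ 0 → ∀ (x : Fin g ⊕ Fin g → ZMod M) (v : Fin g ⊕ Fin g → ℚ),
          AdelicCongr ((r⁻¹ : gspFinAdelic δ) : GL (Fin g ⊕ Fin g) finAdeleQ) 1 v (fun i => ((x i).val : ℚ) / M) →
            ((Λ.lift M (Multiplicative.ofAdd x)) : (P.A.fibre (φT t).left).toAbelianVariety.Points ℂ) = m.r v) ∧
        m.γ = 1 ∧ (∀ v : Fin g ⊕ Fin g → ℝ, m.Ψ v = siegelPeriodMap δ (s t) v)) →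
  ∃ (V'' : Set MT) (_ : IsOpen V'') (_ : t₀ ∈ V'') (hV''U : V'' ⊆ U)
    (Φ : MT → ((Fin g ⊕ Fin g → ℝ) ≃L[ℝ] (Fin g → ℂ))) (ex : MT × (Fin g → ℂ) → MA),
    (∀ t ∈ V'', ∀ v : Fin g ⊕ Fin g → ℝ, Φ t v = siegelPeriodMap δ (s t) v) ∧
    IsRelExpChartOn (Fin d → ℂ) (Fin (d + g) → ℂ) (basePoint hT P.A φA) V'' Φ ex ∧
    (∀ t ∈ V'', ∃ φt : ComplexTorus (Φ t) → (P.A.fibre (φT t).left).toAbelianVariety.Points ℂ,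
      IsAnalytification (Fin g → ℂ) (P.A.fibre (φT t).left).toAbelianVariety.X g φt ∧
      (∀ x y, φt (x + y) = φt x * φt y) ∧
      ∀ z : Fin g → ℂ, (φA (ex (t, z))).left = P.A.fibrePointToLeft (φT t).left (φt (cover (Φ t) z))) ∧
    (∀ (u : finAdeleQˣ) (r : gspFinAdelic δ),
      (∀ v, Valued.v ((u : finAdeleQ) v) = 1) →
      (u : finAdeleQ) - ((c : ZMod N).val : ℕ) ∈ levelIdeal N →
      r ∈ principalLevelSubgroup δ 1 →
      IsMultiplier (typeFormOver δ finAdeleQ) (r : GL (Fin g ⊕ Fin g) finAdeleQ) u →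
      ((r : GL (Fin g ⊕ Fin g) finAdeleQ) : Matrix (Fin g ⊕ Fin g) (Fin g ⊕ Fin g) finAdeleQ) =
        Matrix.fromBlocks 1 0 0 ((u : finAdeleQ) • (1 : Matrix (Fin g) (Fin g) finAdeleQ)) →
      ∀ (t : MT) (ht : t ∈ V''),
        ∃ (m : SiegelAdelicMarking ⟨jOfSiegel δ (s t), SiegelComplexRecordSystem.jOfSiegel_mem_C0pm hδ.1 (hs t (hV''U ht))⟩ r
              (P.A.fibre (φT t).left).toAbelianVariety)
          (Θ : CartierDivisor (P.A.fibre (φT t).left).toAbelianVariety.X.left)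
          (Λ : P.level.SymplecticLift (φT t).left Θ δ),
          Θ.IsAmple ∧ P.A.IsLambdaOfAt (φT t).left P.D P.pol.lam Θ ∧
          (∀ ⦃M : ℕ⦄, N ∣ M → M ≠ 0 → ∀ (x : Fin g ⊕ Fin g → ZMod M) (v : Fin g ⊕ Fin g → ℚ),
            AdelicCongr ((r⁻¹ : gspFinAdelic δ) : GL (Fin g ⊕ Fin g) finAdeleQ) 1 v (fun i => ((x i).val : ℚ) / M) →
              ((Λ.lift M (Multiplicative.ofAdd x)) : (P.A.fibre (φT t).left).toAbelianVariety.Points ℂ) = m.r v) ∧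
          m.γ = 1 ∧ (∀ v : Fin g ⊕ Fin g → ℝ, m.Ψ v = siegelPeriodMap δ (s t) v) ∧
          ∀ z : Fin g → ℂ, P.A.fibrePointToLeft (φT t).left (m.toFun (cover m.Ψ z)) = (φA (ex (t, z))).left) := by
  intro g N δ hg hδ hN 𝓜 c Sc ιc _unif _ _ _ _ _ _ T d _ _ _ ψ MT _ _ _ φT hT MA _ _ _ φA _ U _ s hs hsd _ t₀ V' hV'o ht₀ hV'U Z hZ hZd
    hZ₀ Φ₂ ex₂ hΦ₂ hex₂ hG hADMZ hADMs
  exact Literature.AlgebraicGeometry.ModuliOfAbelianVarieties.SiegelUniversalFamilyChartMatch.match_chart g N δ hg hδ hN 𝓜 c Sc ιc T d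
    ψ MT φT hT MA φA U s hs hsd t₀ V' hV'o ht₀ hV'U Z hZ hZd hZ₀ Φ₂ ex₂ hΦ₂ hex₂ hG hADMZ hADMs

/-- **Organ O6 `GLUE` — uniqueness gluing of local tautological charts over `U`.**  Under P-3's binders: if every `t₀ ∈ U` has an open
`V'' ∋ t₀`, `V'' ⊆ U`, carrying a chart with the FOUR P-3 conjuncts at `s`, then `U` carries one (two such charts agree pointwise on
overlaps: their fibre maps are torus maps of admissible markings with the same `(J, r, Ψ)` and matched symplectic lifts —
★ `SiegelAdelicMarking.toFun_eq_toFun_of_lifts` — and `φA`, `fibrePointToLeft` are injective; ★ `IsRelExpChartOn` is local on the base).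
[cite: Lange2023AbelianVarietiesComplex, §3.4 Ex. 3.4.5 (7) p. 191] [cite: BirkenhakeLange2004, §8.7 Lemma 8.7.1 p. 230] [cite: Milne2005ShimuraVarieties, §6 Thm. 6.11 p. 74]
PROOF. **Organ O6 — PROVED** (LA7-p02 (g0), ★ p847935 `SiegelUniversalFamilyChartGluing`): the P-3 fibre normal form is RIGID
(`fibreDatum_rigid`: two charts in normal form at `s` have the same frame `Π_s` and the same fibre map, by ★ `toFun_eq_toFun_of_lifts`
[Milne Thm. 6.11 ∕ Serre's lemma, `N ≥ 3`] + injectivity of `φA` and of `fibrePointToLeft`), so the local charts glue along `U`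
(★ CHART-GLUE `IsRelExpChartOn.exists_chart_of_local_of_rigid`); head `chart_of_local` = `GLUE` minus its unused binders.
[cite: Milne2005ShimuraVarieties, §6 Thm. 6.11 p. 74] [cite: Lange2023AbelianVarietiesComplex, §3.4 Prop. 3.4.8 p. 190] -/
theorem organ_glue :
  ∀ (g N : ℕ) (δ : Fin g → ℕ) (_hg : 0 < g) (hδ : IsPolarizationType δ) (_hN : 3 ≤ N) (𝓜 : SiegelFineModuliScheme g N δ)
    -- a piece of `𝓜 ⊗ ℂ` with its uniformisation, satisfying the (U2+) clauses of ★ `siegelModuli_complexUniformisation` (P-3 :110–:121 verbatim)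
    (c : (ZMod N)ˣ) (Sc : SchemeOver ℂ) (ιc : Sc ⟶ (Motives.baseChange ℚ ℂ).obj 𝓜.M)
    (unif : Matrix (Fin g) (Fin g) ℂ → ComplexPoints Sc)
    (_ : ContinuousOn unif (siegelUpperHalfSpace g)) (_ : IsOpenMap ((siegelUpperHalfSpace g).restrict unif))
    (_ : Set.SurjOn unif (siegelUpperHalfSpace g) Set.univ)
    (_ : ∀ Z ∈ siegelUpperHalfSpace g, ∀ Z' ∈ siegelUpperHalfSpace g,
      unif Z = unif Z' ↔ ∃ M ∈ siegelLevelGroup δ N, ∃ C : (Fin g → ℂ) ≃ₗ[ℂ] (Fin g → ℂ),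
        ∀ v : Fin g ⊕ Fin g → ℝ, C (siegelPeriodMap δ Z v) = siegelPeriodMap δ Z' (intAct M v))
    (_ : ∀ (V : Sc.left.affineOpens) (f : Sc.left.presheaf.obj (Opposite.op (↑V : Sc.left.Opens))),
      DifferentiableOn ℂ (fun Z ↦ AlgPoints.evalOrZero (↑V : Sc.left.Opens) f (unif Z))
        (siegelUpperHalfSpace g ∩ unif ⁻¹' {P | P.pt ∈ (↑V : Sc.left.Opens)}))
    -- the (U3) junction for this piece (P-3 :123–:140 verbatim)
    (_ : ∀ (u : finAdeleQˣ) (r : gspFinAdelic δ),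
      (∀ v, Valued.v ((u : finAdeleQ) v) = 1) →
      (u : finAdeleQ) - ((c : ZMod N).val : ℕ) ∈ levelIdeal N →
      r ∈ principalLevelSubgroup δ 1 →
      IsMultiplier (typeFormOver δ finAdeleQ) (r : GL (Fin g ⊕ Fin g) finAdeleQ) u →
      ((r : GL (Fin g ⊕ Fin g) finAdeleQ) : Matrix (Fin g ⊕ Fin g) (Fin g ⊕ Fin g) finAdeleQ) =
        Matrix.fromBlocks 1 0 0 ((u : finAdeleQ) • (1 : Matrix (Fin g) (Fin g) finAdeleQ)) →
      ∀ (Z : Matrix (Fin g) (Fin g) ℂ) (hZ : Z ∈ siegelUpperHalfSpace g),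
        haveI : IsLocallyNoetherian (specOver ℚ ℂ).left :=
          inferInstanceAs (IsLocallyNoetherian (Spec (CommRingCat.of ℂ)))
        (∃ (P' : PolarizedAbelianSchemeWithLevel g N δ (specOver ℚ ℂ).left)
            (G : P'.A.X.left ⟶ 𝓜.univ.A.X.left) (Ĝ : P'.D.hat.X.left ⟶ 𝓜.univ.D.hat.X.left),
            P'.IsBaseChangeVia 𝓜.univ
                ((AlgPoints.baseChangeEquiv (algebraMap ℚ ℂ) 𝓜.M).symm (AlgPoints.map ιc (unif Z))).left G Ĝ ∧
            IsAdmissibleAt hδ r Z hZ P') ∧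
        (∀ (P' : PolarizedAbelianSchemeWithLevel g N δ (specOver ℚ ℂ).left), IsAdmissibleAt hδ r Z hZ P' →
            AlgPoints.map ιc (unif Z)
              = AlgPoints.baseChangeEquiv (algebraMap ℚ ℂ) 𝓜.M (𝓜.classifyingMap (specOver ℚ ℂ) P')))
    -- a smooth complex variety over the piece and the pulled-back universal triple (P-3 :142–:158 verbatim)
    (T : SchemeOver ℂ) (d : ℕ) [LocallyOfFiniteType T.hom] [IsSeparated T.hom] [SmoothOfRelativeDimension d T.hom] (ψ : T ⟶ Sc)
    (MT : Type) [TopologicalSpace MT] [ChartedSpace (Fin d → ℂ) MT] [IsManifold 𝓘(ℂ, Fin d → ℂ) ω MT]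
    (φT : MT → ComplexPoints T) (hT : IsAnalytification (Fin d → ℂ) T d φT)
    (MA : Type) [TopologicalSpace MA] [ChartedSpace (Fin (d + g) → ℂ) MA] [IsManifold 𝓘(ℂ, Fin (d + g) → ℂ) ω MA]
    (φA : MA → ComplexPoints (totalOver T
      (𝓜.univ.baseChange (ψ.left ≫ ιc.left ≫ pullback.fst 𝓜.M.hom (Spec.map (CommRingCat.ofHom (algebraMap ℚ ℂ))))).A))
    (_ : IsAnalytification (Fin (d + g) → ℂ) (totalOver T
      (𝓜.univ.baseChange (ψ.left ≫ ιc.left ≫ pullback.fst 𝓜.M.hom (Spec.map (CommRingCat.ofHom (algebraMap ℚ ℂ))))).A) (d + g) φA)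
    (U : Set MT) (_ : IsOpen U) (s : MT → Matrix (Fin g) (Fin g) ℂ) (hs : ∀ t ∈ U, s t ∈ siegelUpperHalfSpace g)
    (_ : ∀ i j, MDifferentiableOn 𝓘(ℂ, Fin d → ℂ) 𝓘(ℂ, ℂ) (fun t => s t i j) U)
    (_ : ∀ t ∈ U, unif (s t) = AlgPoints.map ψ (φT t)),
  letI P := 𝓜.univ.baseChange (ψ.left ≫ ιc.left ≫ pullback.fst 𝓜.M.hom (Spec.map (CommRingCat.ofHom (algebraMap ℚ ℂ))))
  (∀ t₀ ∈ U, ∃ (V'' : Set MT) (_ : IsOpen V'') (_ : t₀ ∈ V'') (hV''U : V'' ⊆ U)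
      (Φ : MT → ((Fin g ⊕ Fin g → ℝ) ≃L[ℝ] (Fin g → ℂ))) (ex : MT × (Fin g → ℂ) → MA),
      (∀ t ∈ V'', ∀ v : Fin g ⊕ Fin g → ℝ, Φ t v = siegelPeriodMap δ (s t) v) ∧
      IsRelExpChartOn (Fin d → ℂ) (Fin (d + g) → ℂ) (basePoint hT P.A φA) V'' Φ ex ∧
      (∀ t ∈ V'', ∃ φt : ComplexTorus (Φ t) → (P.A.fibre (φT t).left).toAbelianVariety.Points ℂ,
        IsAnalytification (Fin g → ℂ) (P.A.fibre (φT t).left).toAbelianVariety.X g φt ∧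
        (∀ x y, φt (x + y) = φt x * φt y) ∧
        ∀ z : Fin g → ℂ, (φA (ex (t, z))).left = P.A.fibrePointToLeft (φT t).left (φt (cover (Φ t) z))) ∧
      (∀ (u : finAdeleQˣ) (r : gspFinAdelic δ),
        (∀ v, Valued.v ((u : finAdeleQ) v) = 1) →
        (u : finAdeleQ) - ((c : ZMod N).val : ℕ) ∈ levelIdeal N →
        r ∈ principalLevelSubgroup δ 1 →
        IsMultiplier (typeFormOver δ finAdeleQ) (r : GL (Fin g ⊕ Fin g) finAdeleQ) u →
        ((r : GL (Fin g ⊕ Fin g) finAdeleQ) : Matrix (Fin g ⊕ Fin g) (Fin g ⊕ Fin g) finAdeleQ) =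
          Matrix.fromBlocks 1 0 0 ((u : finAdeleQ) • (1 : Matrix (Fin g) (Fin g) finAdeleQ)) →
        ∀ (t : MT) (ht : t ∈ V''),
          ∃ (m : SiegelAdelicMarking ⟨jOfSiegel δ (s t), SiegelComplexRecordSystem.jOfSiegel_mem_C0pm hδ.1 (hs t (hV''U ht))⟩ r
                (P.A.fibre (φT t).left).toAbelianVariety)
            (Θ : CartierDivisor (P.A.fibre (φT t).left).toAbelianVariety.X.left)
            (Λ : P.level.SymplecticLift (φT t).left Θ δ),
            Θ.IsAmple ∧ P.A.IsLambdaOfAt (φT t).left P.D P.pol.lam Θ ∧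
            (∀ ⦃M : ℕ⦄, N ∣ M → M ≠ 0 → ∀ (x : Fin g ⊕ Fin g → ZMod M) (v : Fin g ⊕ Fin g → ℚ),
              AdelicCongr ((r⁻¹ : gspFinAdelic δ) : GL (Fin g ⊕ Fin g) finAdeleQ) 1 v (fun i => ((x i).val : ℚ) / M) →
                ((Λ.lift M (Multiplicative.ofAdd x)) : (P.A.fibre (φT t).left).toAbelianVariety.Points ℂ) = m.r v) ∧
            m.γ = 1 ∧ (∀ v : Fin g ⊕ Fin g → ℝ, m.Ψ v = siegelPeriodMap δ (s t) v) ∧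
            ∀ z : Fin g → ℂ, P.A.fibrePointToLeft (φT t).left (m.toFun (cover m.Ψ z)) = (φA (ex (t, z))).left)) →
  ∃ (Φ : MT → ((Fin g ⊕ Fin g → ℝ) ≃L[ℝ] (Fin g → ℂ))) (ex : MT × (Fin g → ℂ) → MA),
    (∀ t ∈ U, ∀ v : Fin g ⊕ Fin g → ℝ, Φ t v = siegelPeriodMap δ (s t) v) ∧
    IsRelExpChartOn (Fin d → ℂ) (Fin (d + g) → ℂ) (basePoint hT P.A φA) U Φ ex ∧
    (∀ t ∈ U, ∃ φt : ComplexTorus (Φ t) → (P.A.fibre (φT t).left).toAbelianVariety.Points ℂ,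
      IsAnalytification (Fin g → ℂ) (P.A.fibre (φT t).left).toAbelianVariety.X g φt ∧
      (∀ x y, φt (x + y) = φt x * φt y) ∧
      ∀ z : Fin g → ℂ, (φA (ex (t, z))).left = P.A.fibrePointToLeft (φT t).left (φt (cover (Φ t) z))) ∧
    (∀ (u : finAdeleQˣ) (r : gspFinAdelic δ),
      (∀ v, Valued.v ((u : finAdeleQ) v) = 1) →
      (u : finAdeleQ) - ((c : ZMod N).val : ℕ) ∈ levelIdeal N →
      r ∈ principalLevelSubgroup δ 1 →
      IsMultiplier (typeFormOver δ finAdeleQ) (r : GL (Fin g ⊕ Fin g) finAdeleQ) u →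
      ((r : GL (Fin g ⊕ Fin g) finAdeleQ) : Matrix (Fin g ⊕ Fin g) (Fin g ⊕ Fin g) finAdeleQ) =
        Matrix.fromBlocks 1 0 0 ((u : finAdeleQ) • (1 : Matrix (Fin g) (Fin g) finAdeleQ)) →
      ∀ (t : MT) (ht : t ∈ U),
        ∃ (m : SiegelAdelicMarking ⟨jOfSiegel δ (s t), SiegelComplexRecordSystem.jOfSiegel_mem_C0pm hδ.1 (hs t ht)⟩ r
              (P.A.fibre (φT t).left).toAbelianVariety)
          (Θ : CartierDivisor (P.A.fibre (φT t).left).toAbelianVariety.X.left)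
          (Λ : P.level.SymplecticLift (φT t).left Θ δ),
          Θ.IsAmple ∧ P.A.IsLambdaOfAt (φT t).left P.D P.pol.lam Θ ∧
          (∀ ⦃M : ℕ⦄, N ∣ M → M ≠ 0 → ∀ (x : Fin g ⊕ Fin g → ZMod M) (v : Fin g ⊕ Fin g → ℚ),
            AdelicCongr ((r⁻¹ : gspFinAdelic δ) : GL (Fin g ⊕ Fin g) finAdeleQ) 1 v (fun i => ((x i).val : ℚ) / M) →
              ((Λ.lift M (Multiplicative.ofAdd x)) : (P.A.fibre (φT t).left).toAbelianVariety.Points ℂ) = m.r v) ∧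
          m.γ = 1 ∧ (∀ v : Fin g ⊕ Fin g → ℝ, m.Ψ v = siegelPeriodMap δ (s t) v) ∧
          ∀ z : Fin g → ℂ, P.A.fibrePointToLeft (φT t).left (m.toFun (cover m.Ψ z)) = (φA (ex (t, z))).left) := by
  intro g N δ hg hδ hN 𝓜 c Sc ιc _unif _ _ _ _ _ _ T d _ _ _ ψ MT _ _ _ φT hT MA _ _ _ φA hA U _ s hs _ _ hloc
  exact Literature.AlgebraicGeometry.ModuliOfAbelianVarieties.SiegelUniversalFamilyChartGluing.chart_of_local g N δ hg hδ hN 𝓜 c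
    Sc ιc T d ψ MT φT hT MA φA hA U s hs hloc

end SiegelUniversalFamilyUniformisationHolds

/-! ## The head: ★ P-3 `siegelUniversalFamilyUniformisation` is a theorem -/

open SiegelUniversalFamilyUniformisationHolds in
/-- **★ P-3 «UNIV-FAMILY» `siegelUniversalFamilyUniformisation` HOLDS.**  The universal family over a Siegel fine moduli scheme, pulled back
along a smooth complex variety `T → S_c` into a piece of `𝓜 ⊗ ℂ` and analytified, is uniformised over the lift domain `U` by a relative
exponential chart whose period family is the tautological `t ↦ Π_{s t}`, with additive-analytification fibres, whose fibre maps are the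
admissible `[J(s t), r]`-markings in normal form (`γ = 1`, `Ψ = Π_{s t}`) for every principal representative `r` of `c`.  Proof: intro the
binders; `organ_glue` reduces to local charts at each `t₀ ∈ U`; O1 (★ P-1, the theorem ★ `relativeExponentialUniformisation_of_exists_relExpFlow`
★ `exists_relExpFlow`) charts some `U₀ ∋ t₀`; `organ_flat` normalises and propagates on `V' ∋ t₀` using the packages of `organ_admnf`;
`organ_align` re-frames to `Π_Z`; `organ_match` identifies `Z = s` on `V'' ∋ t₀`.
[cite: Lange2023AbelianVarietiesComplex, §3.4 Prop. 3.4.1 + Lemma 3.4.7 + Prop. 3.4.8 + Ex. 3.4.5 (7) pp. 186–191] [cite: BirkenhakeLange2004, §8.7–§8.8 pp. 229–234] -/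
theorem siegelUniversalFamilyUniformisation_holds : siegelUniversalFamilyUniformisation := by
  -- O1 (★ P-1, a theorem of the tree since 2026-09-02): the relative exponential uniformisation of an analytified abelian scheme
  have h₁ : relativeExponentialUniformisation :=
    Literature.Geometry.ComplexAnalytic.relativeExponentialUniformisation_of_exists_relExpFlow
      Literature.Geometry.ComplexAnalytic.exists_relExpFlow
  intro g N δ hg hδ hN 𝓜 c Sc ιc unif hu₁ hu₂ hu₃ hu₄ hu₅ hU3 T d _i₁ _i₂ _i₃ ψ MT _i₄ _i₅ _i₆ φT hT MA _i₇ _i₈ _i₉ φA hA U hU s hs hsd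
    hlift
  refine organ_glue g N δ hg hδ hN 𝓜 c Sc ιc unif hu₁ hu₂ hu₃ hu₄ hu₅ hU3 T d ψ MT φT hT MA φA hA U hU s hs hsd hlift ?_
  intro t₀ ht₀
  -- O2: the normal-form packages along `U`
  have hNF := organ_admnf g N δ hg hδ hN 𝓜 c Sc ιc unif hu₁ hu₂ hu₃ hu₄ hu₅ hU3 T d ψ MT φT hT MA φA hA U hU s hs hsd hlift
  -- O1: a relative exponential chart of `(P.A)^an → T^an` near `t₀`
  obtain ⟨U₀, ht₀U₀, Φ₀, ex₀, hC₀, hG₀⟩ :=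
    h₁ T d _ g (PolarizedAbelianSchemeWithLevel.relDim _) MT φT hT MA φA hA t₀
  -- O3: normalise at `t₀`, propagate along the frame
  obtain ⟨V', hV'o, ht₀V', hV'U, Φ₁, ex₁, Z, hZ, hZ₀, hC₁, hG₁, hADM₁⟩ :=
    organ_flat g N δ hg hδ hN 𝓜 c Sc ιc unif hu₁ hu₂ hu₃ hu₄ hu₅ hU3 T d ψ MT φT hT MA φA hA U hU s hs hsd hlift
      t₀ ht₀ U₀ Φ₀ ex₀ ht₀U₀ hC₀ hG₀ hNF
  -- O4: Riemann relations, re-frame to `Π_Z`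
  obtain ⟨Φ₂, ex₂, hZd, hT₂, hC₂, hG₂, hADM₂⟩ :=
    organ_align g N δ hg hδ hN 𝓜 c Sc ιc unif hu₁ hu₂ hu₃ hu₄ hu₅ hU3 T d ψ MT φT hT MA φA hA U hU s hs hsd hlift
      V' hV'o hV'U Φ₁ ex₁ Z hZ hC₁ hG₁ hADM₁
  -- O5: `Z = s` near `t₀`
  obtain ⟨V'', hV''o, ht₀V'', hV''U, Φ, ex, hT, hC, hG, hADM⟩ :=
    organ_match g N δ hg hδ hN 𝓜 c Sc ιc unif hu₁ hu₂ hu₃ hu₄ hu₅ hU3 T d ψ MT φT hT MA φA hA U hU s hs hsd hlift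
      t₀ V' hV'o ht₀V' hV'U Z hZ hZd hZ₀ Φ₂ ex₂ hT₂ hC₂ hG₂ hADM₂ hNF
  exact ⟨V'', hV''o, ht₀V'', hV''U, Φ, ex, hT, hC, hG, hADM⟩

/- TIE: the statement proved is the ★ P-3 constant token for token (`rfl` on types); the E-LINE socket `stub_UNIVFAM`
(`Summits/…/Cruxes/HLiu418/Lines/F0_P6a_PELWitnessE.lean` :655) and the workfile head `…StubUNIVFAM.stub_UNIVFAM_closed` have this
same type, so any consumer may write `:= Literature.AlgebraicGeometry.ModuliOfAbelianVarieties.siegelUniversalFamilyUniformisation_holds`. -/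
example : type_of% @siegelUniversalFamilyUniformisation_holds = siegelUniversalFamilyUniformisation := rfl

end Literature.AlgebraicGeometry.ModuliOfAbelianVarieties

end
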